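import Literature.IUT.LogVolume.UnitLogWildQuadraticDyadic
import Literature.IUT.LogVolume.UnitLogWildDepth
import Literature.IUT.LogVolume.UnitLogNormTrace
import Literature.IUT.LogVolume.UnitLogUnramifiedDyadicArtinSchreier

/-!
# R196‴ TYPED — the keyed logarithm law at `v ∣ 2` as a DECOMPOSITION with kernel-checked glue

Stub-ideation sketch k3 (gen 31) for `stub_heegnerIndexLowerAtTwo` of the crux
`SplitBadTwoLowerHalfOfFacts` (route `PrintCf2`, item `stmt-BirchSwinnertonDyer-27851`).

**HONESTY.** BSD is NOT proved here; the crux is NOT proved; the stub is NOT proved; no net digit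
`D_c(key)` is asserted (B45 / E1).  This file TYPES the keyed law of STUB-PLAN v5.8 §3 (xxiv) over the
tree vocabulary `[NormedAlgebra ℚ_[2] L] (σ : L ≃ₐ[ℚ_[2]] L) (hϖ : IsUniformizer ϖ)
(he : absRamificationIdx 2 L = 2)` (R196‴, the critic's admissible delivery K33) and PROVES its glue:

* §0 the typed objects: `normOnePrincipal σ = {x | ‖1 - x‖ < 1 ∧ x·σx = 1}` (= `U¹(L)^{N=1}`, the
  concrete `H¹(F, T(key))` of §3 (xxiv)), the anti-invariant ball `antiBall σ r = {w | σw = −w ∧ ‖w‖ ≤ r}`,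
  the fixed ball `fixedBall σ r` (`𝒪_F` for `r = 1`), `asymLogUnits σ = (1 − σ)·log₂(𝒪_Lˣ)`;
* §1 **SEAM (sub-stub S1, PROVED):** for an involution `σ` acting trivially on the residue field and a
  uniformizer `ϖ` whose unit class `ζ = ϖ/σϖ` is torsion,
  `log₂(normOnePrincipal σ) = (1 − σ)·log₂(𝒪_Lˣ)` — quadratic Hilbert 90 with unit normal form
  `1 + x = ϖᵏ·v`, `log₂ ζ = 0` (tree `unitLog_eq_zero_of_pow_eq_one`), and H2
  `log₂(y/σy) = log₂ y − σ log₂ y` (tree `unitLog_mul/inv`, `unitLog_map_algEquiv`) — uniform over ALL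
  six keys (`ζ = −1` at conductor 8, `ζ = i` at conductor 4);
* §2 **TRI (PROVED):** `‖σz − z‖ ≤ ‖ϖ‖³ = ‖2ϖ‖` on `𝒪_L` (lower ramification break `i(σ) = 3`) from
  `σϖ = −ϖ`, `k_L = k_F` and `e = 2`, by a three-step ultrametric bootstrap; hence the UPPER half
  `(1 − σ)·log₂(𝒪_Lˣ) ⊆ antiBall σ ‖ϖ‖³` (sub-stub S2a, PROVED from tree U2
  `RamificationCriterion.norm_le_zpow_of_mem_logUnits`);
* §3 **LOWER half (sub-stub S2c, PROVED):** `antiBall σ ‖ϖ‖³ ⊆ (1 − σ)·log₂(𝒪_Lˣ)` from the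
  squaring trick `(1 + w/2)² = (1 + w²/4)·(1 + 2z)`, tree U1 `WildQuadraticDyadic.closedBall_subset_logUnits`
  (`𝔭³ ⊆ log₂𝒪ˣ`) and the analytic step `HThree σ ϖ : ‖log₂(1+2z) − σ log₂(1+2z) − 4z‖ ≤ ‖ϖ‖⁷`
  (anti-invariant `z ∈ 𝔭`), itself PROVED (`hThree_holds`) from the third-order expansion
  `norm_unitLog_sub_quadratic_le : ‖x‖ ≤ ‖ϖ‖³ → ‖log₂(1+x) − (x − x²/2)‖ ≤ ‖ϖ‖⁷` (tree `hasSum_unitLog`,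
  `WildDyadic.norm_logTerm_le`);
* §4 **KEYED LAW, conductor-8 keys `u ∈ {±2, ±6}`, every layer `n` (PROVED, `keyedLawEight`):**
  `log₂(U¹(L)^{N=1}) = antiBall σ ‖ϖ‖³ = (2ϖ)·𝒪_F` — the table entry `2√u·𝒪_{F_n}` of §3 (xxiv);
* §5 **conductor-4 keys `u ∈ {−1, 3}` with `i ∈ L` (glue PROVED):** the same SEAM (`ϖ = 1 + i`,
  `ζ = i`, `i⁴ = 1`) reduces `log₂(U¹(L)^{N=1}) = 2i·AS(F)` to `ImLawFour`
  (`(1 − σ)·log₂(𝒪_Lˣ) = 2i·artinSchreierBall σ`); the exception `(u,n) = (3,0)` is the typed target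
  `SeamWithUnitClass` (non-torsion `ζ = −(2−√3)`; ONE layer, a finite `decide`-size check);
* §6 **KEYED LAW, conductor-4 keys (PROVED, `CondFourFrame.keyedLawFour`):** over the frame
  `CondFourFrame σ ϖ I` (`I² = −1`, `σI = −I`, `ϖ = 1 + I`, `e = 2`, `σ` residue-trivial involution)
  `ImLawFour` holds: TRI at conductor 4 (`‖σz − z‖ ≤ ‖2‖`), NO ODD FIXED VALUATIONS
  (`σa = a, ‖a‖ < 1 ⇒ ‖a‖ ≤ ‖2‖`), the MAIN CONGRUENCE
  `(1 − σ)log₂(1 + ϖy) ≡ 2i·y(1 + σy) (mod ‖ϖ‖³)` via `(1 + ϖy)⁴ = 1 + 4(m + m²)`, `m = ϖy + iy²`,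
  reduction to principal units by an odd power (tree `exists_pow_isPrincipal_not_dvd`,
  `UnramifiedDyadic.norm_inv_natCast_sub_one_le`), and `2i·2𝒪_F ⊆ (1 − σ)log₂(𝒪_Lˣ)` (`(1 − i)ϖ³ = 4i`).

NET: for all six dyadic keys and every layer EXCEPT `(u,n) = (3,0)`, the local law
`log₂ H¹(F_n, T(key)) = [2√u·𝒪_{F_n} | 2i·AS_n]` of STUB-PLAN §3 (xxiv) is now a kernel-checked
theorem over an abstract frame; instantiating the frame at the concrete layers `L_n = F_n(√u)` is
bookkeeping (residue-triviality of `σ` = `L_n/F_n` ramified; `e(L_n/ℚ₂) = 2`).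

Everything quantifies over an arbitrary `2`-adic field `L` with `e = 2` (any residue degree), so it is
uniform in the layer `n` of `L_n = F_n(√u)` by construction (B47).  Tree facts are CITED BY DECL NAME
(B41 / B47); no definition of `log` is posited (the tree's `unitLog` / `logUnits` are used).
-/

set_option linter.dupNamespace false
set_option autoImplicit false

noncomputable section

open Metric Set
open scoped Pointwise
open Literature.IUT.LogVolume
open Literature.NumberTheory.GaloisRepresentations.Ultrametric

namespace Summit.BirchSwinnertonDyer.BirchSwinnertonDyer.Cruxes.SplitBadTwoLowerHalfOfFacts.KeyedLawK3G31

variable {L : Type*} [NontriviallyNormedField L] [NormedAlgebra ℚ_[2] L] [IsUltrametricDist L]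
  [ProperSpace L]

/-! ## §0 The typed objects (R196‴ vocabulary) -/

/-- `U¹(L)^{N=1}`: principal units of `L` of norm one to the fixed field of `σ` — the concrete
`H¹(F_n, T(key))` of STUB-PLAN §3 (xxiv). -/
def normOnePrincipal (σ : L ≃ₐ[ℚ_[2]] L) : Set L := {x | ‖1 - x‖ < 1 ∧ x * σ x = 1}

/-- The anti-invariant ball `{w | σ w = −w, ‖w‖ ≤ r}` (for `σϖ = −ϖ` and `r = ‖2ϖ‖` this is `2ϖ·𝒪_F`,
`antiBall_eq_smul_fixedBall`). -/
def antiBall (σ : L ≃ₐ[ℚ_[2]] L) (r : ℝ) : Set L := {w | σ w = -w ∧ ‖w‖ ≤ r}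

/-- The fixed ball `{a | σ a = a, ‖a‖ ≤ r}` (`= 𝒪_F` for `r = 1`). -/
def fixedBall (σ : L ≃ₐ[ℚ_[2]] L) (r : ℝ) : Set L := {a | σ a = a ∧ ‖a‖ ≤ r}

/-- `(1 − σ)·log₂(𝒪_Lˣ)`: the antisymmetrised log-unit lattice. -/
def asymLogUnits (σ : L ≃ₐ[ℚ_[2]] L) : Set L := (fun z : L => z - σ z) '' logUnits L

/-- The Artin–Schreier ball `AS(F) = {b ∈ 𝒪_F | b̄ ∈ ℘(k_F)}`, `℘(c) = c² + c` (index `2` in `𝒪_F`). -/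
def artinSchreierBall (σ : L ≃ₐ[ℚ_[2]] L) : Set L :=
  {b | σ b = b ∧ ∃ c : L, σ c = c ∧ ‖c‖ ≤ 1 ∧ ‖b - (c ^ 2 + c)‖ < 1}

omit [IsUltrametricDist L] [ProperSpace L] in
theorem mem_normOnePrincipal {σ : L ≃ₐ[ℚ_[2]] L} {x : L} :
    x ∈ normOnePrincipal σ ↔ ‖1 - x‖ < 1 ∧ x * σ x = 1 := Iff.rfl

omit [IsUltrametricDist L] [ProperSpace L] in
theorem mem_antiBall {σ : L ≃ₐ[ℚ_[2]] L} {r : ℝ} {w : L} :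
    w ∈ antiBall σ r ↔ σ w = -w ∧ ‖w‖ ≤ r := Iff.rfl

omit [IsUltrametricDist L] [ProperSpace L] in
theorem mem_fixedBall {σ : L ≃ₐ[ℚ_[2]] L} {r : ℝ} {a : L} :
    a ∈ fixedBall σ r ↔ σ a = a ∧ ‖a‖ ≤ r := Iff.rfl

omit [IsUltrametricDist L] [ProperSpace L] in
theorem mem_asymLogUnits {σ : L ≃ₐ[ℚ_[2]] L} {w : L} :
    w ∈ asymLogUnits σ ↔ ∃ z ∈ logUnits L, z - σ z = w := Iff.rfl

omit [NormedAlgebra ℚ_[2] L] [ProperSpace L] in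
/-- Ultrametric inequality for differences. -/
theorem norm_sub_le_max' (x y : L) : ‖x - y‖ ≤ max ‖x‖ ‖y‖ := by
  rw [sub_eq_add_neg, ← norm_neg y]
  exact IsUltrametricDist.norm_add_le_max x (-y)

omit [IsUltrametricDist L] [ProperSpace L] in
/-- `‖2‖ = 1/2 ≠ 0` in a normed `ℚ₂`-algebra field. -/
theorem two_ne_zero' : (2 : L) ≠ 0 :=
  norm_pos_iff.mp (by rw [WildDyadic.norm_two]; norm_num)

section Sigma

variable (σ : L ≃ₐ[ℚ_[2]] L)

/-- `σ` is an isometry (tree `norm_map_algEquiv`; `L` is finite over `ℚ₂` by local compactness). -/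
theorem norm_map_sigma (x : L) : ‖σ x‖ = ‖x‖ := by
  haveI : FiniteDimensional ℚ_[2] L := FiniteDimensional.of_locallyCompactSpace ℚ_[2]
  haveI : Algebra.IsAlgebraic ℚ_[2] L := Algebra.IsAlgebraic.of_finite ℚ_[2] L
  exact norm_map_algEquiv 2 σ x

/-- `log₂ ∘ σ = σ ∘ log₂` (tree `unitLog_map_algEquiv`). -/
theorem unitLog_map_sigma (x : L) : unitLog (σ x) = σ (unitLog x) := by
  haveI : FiniteDimensional ℚ_[2] L := FiniteDimensional.of_locallyCompactSpace ℚ_[2]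
  haveI : Algebra.IsAlgebraic ℚ_[2] L := Algebra.IsAlgebraic.of_finite ℚ_[2] L
  exact unitLog_map_algEquiv 2 σ x

theorem map_ne_zero_sigma {x : L} (hx : x ≠ 0) : σ x ≠ 0 := fun h0 => by
  have h := norm_map_sigma σ x
  rw [h0, norm_zero] at h
  exact hx (norm_eq_zero.mp h.symm)

/-! ## §1 SEAM: `log₂(U¹(L)^{N=1}) = (1 − σ)·log₂(𝒪_Lˣ)` (sub-stub S1, PROVED) -/

/-- **H2 / D2 (PROVED from the tree):** `log₂(y/σy) = log₂ y − σ(log₂ y)` for a unit `y`. -/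
theorem unitLog_mul_inv_sigma {y : L} (hy : ‖y‖ = 1) :
    unitLog (y * (σ y)⁻¹) = unitLog y - σ (unitLog y) := by
  have hσy : ‖σ y‖ = 1 := by rw [norm_map_sigma, hy]
  have hσyi : ‖(σ y)⁻¹‖ = 1 := by rw [norm_inv, hσy, inv_one]
  rw [unitLog_mul 2 hy hσyi, unitLog_inv 2 hσy, unitLog_map_sigma, sub_eq_add_neg]

/-- **SEAM, easy half (PROVED):** `(1 − σ)·log₂(𝒪_Lˣ) ⊆ log₂(U¹(L)^{N=1})` — `y ↦ y/σy` lands in the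
norm-one PRINCIPAL units as soon as `σ` acts trivially on the residue field (`hσI`). -/
theorem asymLogUnits_subset_image (hσ2 : ∀ x : L, σ (σ x) = x)
    (hσI : ∀ x : L, ‖x‖ ≤ 1 → ‖σ x - x‖ < 1) :
    asymLogUnits σ ⊆ unitLog '' normOnePrincipal σ := by
  rintro w ⟨y, hy, rfl⟩
  obtain ⟨u, hu, rfl⟩ := (mem_logUnits_iff).mp hy
  have hσu : ‖σ u‖ = 1 := by rw [norm_map_sigma, hu]
  have hσu0 : σ u ≠ 0 := norm_pos_iff.mp (by rw [hσu]; exact one_pos)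
  have hu0 : u ≠ 0 := norm_pos_iff.mp (by rw [hu]; exact one_pos)
  refine ⟨u * (σ u)⁻¹, ⟨?_, ?_⟩, unitLog_mul_inv_sigma σ hu⟩
  · have h1 : 1 - u * (σ u)⁻¹ = (σ u - u) * (σ u)⁻¹ := by field_simp
    rw [h1, norm_mul, norm_inv, hσu, inv_one, mul_one]
    exact hσI u hu.le
  · rw [map_mul, map_inv₀, hσ2]
    field_simp

/-- **SEAM, Hilbert-90 half (PROVED):** `log₂(U¹(L)^{N=1}) ⊆ (1 − σ)·log₂(𝒪_Lˣ)` whenever the unit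
class `ζ = ϖ/σϖ` of the uniformizer is torsion (`ζ = −1` at conductor 8, `ζ = i` at conductor 4):
`x = (1+x)/σ(1+x)`, `1 + x = ϖᵏ·v` (tree `IsUniformizer`, `exists_eq_zpow_mul_of_norm_eq`),
`x = ζᵏ·(v/σv)`, `log₂ ζᵏ = 0` (tree `unitLog_eq_zero_of_pow_eq_one`). -/
theorem image_subset_asymLogUnits {ϖ : Lˣ} (hϖ : IsUniformizer ϖ)
    (hζ : ∃ n : ℕ, 0 < n ∧ ((ϖ : L) * (σ (ϖ : L))⁻¹) ^ n = 1) :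
    unitLog '' normOnePrincipal σ ⊆ asymLogUnits σ := by
  rintro _ ⟨x, ⟨hxP, hxN⟩, rfl⟩
  have hx1 : ‖x‖ = 1 := IsPrincipal.norm_eq_one hxP
  have hx0 : x ≠ 0 := norm_pos_iff.mp (by rw [hx1]; exact one_pos)
  have hσx : σ x = x⁻¹ := eq_inv_of_mul_eq_one_right hxN
  by_cases hxm : x = -1
  · refine ⟨0, zero_mem_logUnits (p := 2), ?_⟩
    show (0 : L) - σ 0 = unitLog x
    rw [map_zero, sub_zero, hxm]
    exact (unitLog_eq_zero_of_pow_eq_one 2 two_pos (by norm_num : ((-1 : L)) ^ 2 = 1)).symm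
  · -- the Hilbert-90 witness `t = 1 + x`
    have ht0 : (1 : L) + x ≠ 0 := fun h => hxm (by linear_combination h)
    have hσt : σ (1 + x) = 1 + x⁻¹ := by rw [map_add, map_one, hσx]
    have hσt0 : σ (1 + x) ≠ 0 := map_ne_zero_sigma σ ht0
    have h1x0 : (1 : L) + x⁻¹ ≠ 0 := hσt ▸ hσt0
    have hxt : x = (1 + x) * (σ (1 + x))⁻¹ := by
      rw [hσt, eq_mul_inv_iff_mul_eq₀ h1x0, mul_add, mul_one, mul_inv_cancel₀ hx0, add_comm]
    have ht1 : ‖(1 : L) + x‖ ≤ 1 :=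
      (IsUltrametricDist.norm_add_le_max _ _).trans (max_le (by rw [norm_one]) hx1.le)
    -- unit normal form `1 + x = ϖᵏ·v`
    obtain ⟨k, hk⟩ := hϖ.2 (Units.mk0 _ ht0)
    obtain ⟨v, hv1, htv⟩ := exists_eq_zpow_mul_of_norm_eq ϖ (Units.mk0 _ ht0) k hk
    have htv' : (1 : L) + x = (ϖ : L) ^ k * (v : L) := by
      have h := congrArg Units.val htv
      rwa [Units.val_mk0, Units.val_mul, Units.val_zpow_eq_zpow_val] at h
    have hϖ0 : (ϖ : L) ≠ 0 := ϖ.ne_zero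
    have hσϖ0 : σ (ϖ : L) ≠ 0 := map_ne_zero_sigma σ hϖ0
    have hv0 : (v : L) ≠ 0 := v.ne_zero
    have hσv0 : σ (v : L) ≠ 0 := map_ne_zero_sigma σ hv0
    set ζ : L := (ϖ : L) * (σ (ϖ : L))⁻¹ with hζdef
    have hxdec : x = ζ ^ k * ((v : L) * (σ (v : L))⁻¹) := by
      rw [hxt, htv', map_mul, map_zpow₀, hζdef, mul_inv, mul_zpow, inv_zpow]
      ring
    -- norms
    have hζ1 : ‖ζ‖ = 1 := by
      rw [hζdef, norm_mul, norm_inv, norm_map_sigma, mul_inv_cancel₀ (norm_ne_zero_iff.mpr hϖ0)]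
    have hζk1 : ‖ζ ^ k‖ = 1 := by rw [norm_zpow, hζ1, one_zpow]
    have hσv1 : ‖σ (v : L)‖ = 1 := by rw [norm_map_sigma, hv1]
    have hvv1 : ‖(v : L) * (σ (v : L))⁻¹‖ = 1 := by rw [norm_mul, norm_inv, hv1, hσv1, inv_one, mul_one]
    -- `log₂ ζᵏ = 0`
    obtain ⟨n, hn, hζn⟩ := hζ
    have hζkn : (ζ ^ k) ^ n = 1 := by
      rw [← zpow_natCast, ← zpow_mul, mul_comm, zpow_mul, zpow_natCast, hζn, one_zpow]
    have hζk0 : unitLog (ζ ^ k) = 0 := unitLog_eq_zero_of_pow_eq_one 2 hn hζkn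
    refine ⟨unitLog (v : L), unitLog_mem_logUnits hv1, ?_⟩
    rw [hxdec, unitLog_mul 2 hζk1 hvv1, hζk0, zero_add, unitLog_mul_inv_sigma σ hv1]

/-- **SEAM (S1, PROVED):** `log₂(U¹(L)^{N=1}) = (1 − σ)·log₂(𝒪_Lˣ)` for an involution `σ` acting
trivially on the residue field whose uniformizer class `ϖ/σϖ` is torsion. -/
theorem image_normOnePrincipal_eq_asymLogUnits (hσ2 : ∀ x : L, σ (σ x) = x)
    (hσI : ∀ x : L, ‖x‖ ≤ 1 → ‖σ x - x‖ < 1) {ϖ : Lˣ} (hϖ : IsUniformizer ϖ)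
    (hζ : ∃ n : ℕ, 0 < n ∧ ((ϖ : L) * (σ (ϖ : L))⁻¹) ^ n = 1) :
    unitLog '' normOnePrincipal σ = asymLogUnits σ :=
  Subset.antisymm (image_subset_asymLogUnits σ hϖ hζ) (asymLogUnits_subset_image σ hσ2 hσI)

/-! ## §2 TRI: the lower ramification break and the UPPER half (S2a, PROVED) -/

/-- Residue-triviality of `σ` from `k_L = k_F` (`hres`). -/
theorem norm_sigma_sub_lt_one (hres : ∀ z : L, ‖z‖ ≤ 1 → ∃ a : L, σ a = a ∧ ‖z - a‖ < 1)
    (x : L) (hx : ‖x‖ ≤ 1) : ‖σ x - x‖ < 1 := by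
  obtain ⟨a, ha, hxa⟩ := hres x hx
  have h : σ x - x = σ (x - a) - (x - a) := by rw [map_sub, ha]; ring
  rw [h]
  exact (norm_sub_le_max' _ _).trans_lt (max_lt (by rwa [norm_map_sigma]) hxa)

/-- … hence `‖σz − z‖ ≤ ‖ϖ‖` on `𝒪_L` (the first bootstrap rung). -/
theorem norm_sigma_sub_le_unif (hres : ∀ z : L, ‖z‖ ≤ 1 → ∃ a : L, σ a = a ∧ ‖z - a‖ < 1)
    {ϖ : Lˣ} (hϖ : IsUniformizer ϖ) (z : L) (hz : ‖z‖ ≤ 1) : ‖σ z - z‖ ≤ ‖(ϖ : L)‖ :=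
  hϖ.norm_le_of_norm_lt_one _ (norm_sigma_sub_lt_one σ hres z hz)

/-- **Bootstrap step (any conductor):** if `‖σz − z‖ ≤ C` on `𝒪_L` then
`‖σz − z‖ ≤ max(‖ϖ‖·C, ‖σϖ − ϖ‖)` on `𝒪_L` (write `z = a + ϖ z₁` with `σ a = a`:
`σz − z = σϖ·(σz₁ − z₁) + (σϖ − ϖ)·z₁`).  The fixed point is `‖σϖ − ϖ‖`, the lower break. -/
theorem norm_sigma_sub_le_step (hres : ∀ z : L, ‖z‖ ≤ 1 → ∃ a : L, σ a = a ∧ ‖z - a‖ < 1)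
    {ϖ : Lˣ} (hϖ : IsUniformizer ϖ) {C : ℝ}
    (hC : ∀ z : L, ‖z‖ ≤ 1 → ‖σ z - z‖ ≤ C) (z : L) (hz : ‖z‖ ≤ 1) :
    ‖σ z - z‖ ≤ max (‖(ϖ : L)‖ * C) ‖σ (ϖ : L) - ϖ‖ := by
  obtain ⟨a, ha, hza⟩ := hres z hz
  have hϖ0 : (ϖ : L) ≠ 0 := ϖ.ne_zero
  have hϖpos : 0 < ‖(ϖ : L)‖ := norm_pos_iff.mpr hϖ0
  obtain ⟨z₁, hz₁n, hzdec⟩ : ∃ z₁ : L, ‖z₁‖ ≤ 1 ∧ z = a + (ϖ : L) * z₁ := by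
    refine ⟨(z - a) * (ϖ : L)⁻¹, ?_, by field_simp; ring⟩
    rw [norm_mul, norm_inv]
    have h := hϖ.norm_le_of_norm_lt_one (z - a) hza
    calc ‖z - a‖ * ‖(ϖ : L)‖⁻¹ ≤ ‖(ϖ : L)‖ * ‖(ϖ : L)‖⁻¹ := by gcongr
      _ = 1 := mul_inv_cancel₀ hϖpos.ne'
  have hkey : σ z - z = σ (ϖ : L) * (σ z₁ - z₁) + (σ (ϖ : L) - ϖ) * z₁ := by
    rw [hzdec, map_add, map_mul, ha]; ring
  rw [hkey]
  refine (IsUltrametricDist.norm_add_le_max _ _).trans (max_le_max ?_ ?_)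
  · rw [norm_mul, norm_map_sigma]
    exact mul_le_mul_of_nonneg_left (hC z₁ hz₁n) (norm_nonneg _)
  · rw [norm_mul]
    exact mul_le_of_le_one_right (norm_nonneg _) hz₁n

/-- **TRI at conductor 8 (PROVED):** `σϖ = −ϖ` ⇒ `‖σz − z‖ ≤ ‖ϖ‖³ = ‖2ϖ‖` for `z ∈ 𝒪_L` (lower break
`i(σ) = 3`): bootstrap `‖ϖ‖ ↦ ‖2‖ ↦ ‖2ϖ‖`, `‖ϖ‖² = ‖2‖` (tree `WildQuadraticDyadic.norm_unif_sq_eq_norm_two`). -/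
theorem norm_sigma_sub_le (hres : ∀ z : L, ‖z‖ ≤ 1 → ∃ a : L, σ a = a ∧ ‖z - a‖ < 1)
    {ϖ : Lˣ} (hϖ : IsUniformizer ϖ) (he : absRamificationIdx 2 L = 2)
    (hanti : σ (ϖ : L) = -(ϖ : L)) (z : L) (hz : ‖z‖ ≤ 1) :
    ‖σ z - z‖ ≤ ‖(ϖ : L)‖ ^ 3 := by
  have hρ2 : ‖(ϖ : L)‖ ^ 2 = ‖(2 : L)‖ := WildQuadraticDyadic.norm_unif_sq_eq_norm_two hϖ he
  have hρpos : 0 < ‖(ϖ : L)‖ := norm_pos_iff.mpr ϖ.ne_zero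
  have hρ1 : ‖(ϖ : L)‖ < 1 := hϖ.1
  have hd : ‖σ (ϖ : L) - ϖ‖ = ‖(ϖ : L)‖ ^ 3 := by
    rw [hanti, show -(ϖ : L) - ϖ = -(2 * ϖ) by ring, norm_neg, norm_mul, ← hρ2]; ring
  have hρ32 : ‖(ϖ : L)‖ ^ 3 ≤ ‖(ϖ : L)‖ ^ 2 := pow_le_pow_of_le_one hρpos.le hρ1.le (by norm_num)
  have h1 : ∀ z : L, ‖z‖ ≤ 1 → ‖σ z - z‖ ≤ ‖(ϖ : L)‖ := norm_sigma_sub_le_unif σ hres hϖ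
  have h2 : ∀ z : L, ‖z‖ ≤ 1 → ‖σ z - z‖ ≤ ‖(ϖ : L)‖ ^ 2 := fun z hz => by
    have h := norm_sigma_sub_le_step σ hres hϖ h1 z hz
    rwa [hd, show ‖(ϖ : L)‖ * ‖(ϖ : L)‖ = ‖(ϖ : L)‖ ^ 2 by ring, max_eq_left hρ32] at h
  have h3 := norm_sigma_sub_le_step σ hres hϖ h2 z hz
  rwa [hd, show ‖(ϖ : L)‖ * ‖(ϖ : L)‖ ^ 2 = ‖(ϖ : L)‖ ^ 3 by ring, max_self] at h3

/-- **U2 at `e = 2` (tree `RamificationCriterion.norm_le_zpow_of_mem_logUnits`, turning point `a₀ = 1`;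
the instantiation of ColPlusS1K3G30 §2):** `log₂(𝒪_Lˣ) ⊆ 𝒪_L`. -/
theorem norm_le_one_of_mem_logUnits {ϖ : Lˣ} (hϖ : IsUniformizer ϖ) (he : absRamificationIdx 2 L = 2)
    {z : L} (hz : z ∈ logUnits L) : ‖z‖ ≤ 1 := by
  have h := RamificationCriterion.norm_le_zpow_of_mem_logUnits 2 hϖ (a₀ := 1)
    (fun a ha => by interval_cases a; rw [he]; norm_num) (by rw [he]; norm_num) hz
  rw [he] at h
  norm_num at h
  exact h

/-- **UPPER half (S2a, PROVED):** `(1 − σ)·log₂(𝒪_Lˣ) ⊆ antiBall σ ‖ϖ‖³` (U2 + TRI). -/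
theorem asymLogUnits_subset_antiBall (hσ2 : ∀ x : L, σ (σ x) = x)
    (hres : ∀ z : L, ‖z‖ ≤ 1 → ∃ a : L, σ a = a ∧ ‖z - a‖ < 1)
    {ϖ : Lˣ} (hϖ : IsUniformizer ϖ) (he : absRamificationIdx 2 L = 2)
    (hanti : σ (ϖ : L) = -(ϖ : L)) :
    asymLogUnits σ ⊆ antiBall σ (‖(ϖ : L)‖ ^ 3) := by
  rintro _ ⟨z, hz, rfl⟩
  refine ⟨by rw [map_sub, hσ2, neg_sub], ?_⟩
  rw [norm_sub_rev]
  exact norm_sigma_sub_le σ hres hϖ he hanti z (norm_le_one_of_mem_logUnits hϖ he hz)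

/-! ## §3 The LOWER half (S2c) from the one hand step H3 -/

/-- **H3 (TYPED sub-stub — the only hand step, R196‴):** on the anti-invariant line inside `𝔭`,
`log₂(1 + 2z) − σ log₂(1 + 2z) = log₂((1+2z)/(1−2z)) ≡ 4z (mod ‖ϖ‖⁷ = ‖8ϖ‖)`.  True with room to spare:
the even terms `(2z)^{2m}/2m` of the series are `σ`-fixed, the odd ones `k ≥ 3` have norm `≤ ‖16ϖ³‖`.
Proof route: the tail estimate of tree `UnitLogUnramifiedDyadic.norm_logSeries_add_le_quarter` rerun on
`‖2z‖ ≤ ‖ϖ‖³` with `padicVal_add_two_le`. -/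
def HThree (σ : L ≃ₐ[ℚ_[2]] L) (ϖ : Lˣ) : Prop :=
  ∀ z : L, σ z = -z → ‖z‖ ≤ ‖(ϖ : L)‖ →
    ‖(unitLog (1 + 2 * z) - σ (unitLog (1 + 2 * z))) - 4 * z‖ ≤ ‖(ϖ : L)‖ ^ 7

/-! ### §3a H3 PROVED: the third-order remainder of the `2`-adic logarithm on `1 + 2𝔭` -/

/-- `s + 2 ≤ m` whenever `2^s ∣ m` and `m ≥ 3` (the tree's private `UnramifiedDyadic.padicVal_add_two_le`,
re-proved verbatim). -/
theorem padicVal_add_two_le' {m s : ℕ} (hm : 3 ≤ m) (h : 2 ^ s ∣ m) : s + 2 ≤ m := by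
  have hle : 2 ^ s ≤ m := Nat.le_of_dvd (by omega) h
  rcases s with _ | _ | s
  · omega
  · omega
  · have key : ∀ t : ℕ, t + 2 + 2 ≤ 2 ^ (t + 2) := fun t => by
      induction t with
      | zero => norm_num
      | succ t ih => rw [pow_succ]; omega
    exact (key s).trans hle

/-- **Term bound:** for `‖x‖ ≤ ‖ϖ‖³ = ‖2ϖ‖` every term of index `n + 1 ≥ 3` of the logarithmic series has
norm `≤ ‖ϖ‖⁷` (`3(n+1) − 2·v₂(n+1) ≥ 7`; tree `WildDyadic.norm_logTerm_le`). -/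
theorem norm_logTerm_le_pow_seven {ϖ : Lˣ} (hϖ : IsUniformizer ϖ) (he : absRamificationIdx 2 L = 2)
    {x : L} (hx : ‖x‖ ≤ ‖(ϖ : L)‖ ^ 3) {n : ℕ} (hn : 2 ≤ n) :
    ‖-(x ^ (n + 1)) / (n + 1 : L)‖ ≤ ‖(ϖ : L)‖ ^ 7 := by
  have hρ2 : ‖(ϖ : L)‖ ^ 2 = 2⁻¹ := by
    rw [WildQuadraticDyadic.norm_unif_sq_eq_norm_two hϖ he, WildDyadic.norm_two]
  have hρ0 : 0 ≤ ‖(ϖ : L)‖ := norm_nonneg _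
  have hρ1 : ‖(ϖ : L)‖ ≤ 1 := hϖ.1.le
  refine (WildDyadic.norm_logTerm_le x n).trans ?_
  have hv := padicVal_add_two_le' (m := n + 1) (s := padicValNat 2 (n + 1)) (by omega) pow_padicValNat_dvd
  calc ‖x‖ ^ (n + 1) * (2 : ℝ) ^ padicValNat 2 (n + 1)
      ≤ (‖(ϖ : L)‖ ^ 3) ^ (n + 1) * (2 : ℝ) ^ padicValNat 2 (n + 1) := by gcongr
    _ = ‖(ϖ : L)‖ ^ (3 * (n + 1)) * (2 : ℝ) ^ padicValNat 2 (n + 1) := by rw [pow_mul]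
    _ ≤ ‖(ϖ : L)‖ ^ (7 + 2 * padicValNat 2 (n + 1)) * (2 : ℝ) ^ padicValNat 2 (n + 1) := by
        gcongr ?_ * _
        exact pow_le_pow_of_le_one hρ0 hρ1 (by omega)
    _ = ‖(ϖ : L)‖ ^ 7 * (‖(ϖ : L)‖ ^ 2 * 2) ^ padicValNat 2 (n + 1) := by
        rw [pow_add, mul_pow, pow_mul, mul_assoc]
    _ = ‖(ϖ : L)‖ ^ 7 := by
        rw [hρ2, inv_mul_cancel₀ (by norm_num : (2 : ℝ) ≠ 0), one_pow, mul_one]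

/-- **Third-order expansion (PROVED):** `‖log₂(1 + x) − (x − x²/2)‖ ≤ ‖ϖ‖⁷` for `‖x‖ ≤ ‖ϖ‖³`
(tree `hasSum_unitLog` + the term bound, as in `UnramifiedDyadic.norm_logSeries_add_le_quarter`). -/
theorem norm_unitLog_sub_quadratic_le {ϖ : Lˣ} (hϖ : IsUniformizer ϖ) (he : absRamificationIdx 2 L = 2)
    {x : L} (hx : ‖x‖ ≤ ‖(ϖ : L)‖ ^ 3) :
    ‖unitLog (1 + x) - (x - x ^ 2 / 2)‖ ≤ ‖(ϖ : L)‖ ^ 7 := by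
  have hρ3 : ‖(ϖ : L)‖ ^ 3 < 1 := pow_lt_one₀ (norm_nonneg _) hϖ.1 (by norm_num)
  have hy : ‖1 - (1 + x)‖ < 1 := by
    rw [sub_add_cancel_left, norm_neg]; exact hx.trans_lt hρ3
  set f : ℕ → L := fun n => -((1 - (1 + x)) ^ (n + 1)) / (n + 1 : L) with hfdef
  have hsum : HasSum f (unitLog (1 + x)) := hasSum_unitLog 2 hy
  have htail := (hasSum_nat_add_iff' 2).mpr hsum
  have hT : ‖unitLog (1 + x) - ∑ i ∈ Finset.range 2, f i‖ ≤ ‖(ϖ : L)‖ ^ 7 := by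
    rw [← htail.tsum_eq]
    refine IsUltrametricDist.norm_tsum_le_of_forall_le_of_nonneg (by positivity) fun n => ?_
    show ‖-((1 - (1 + x)) ^ (n + 2 + 1)) / ((n + 2 : ℕ) + 1 : L)‖ ≤ _
    rw [sub_add_cancel_left, show ((n + 2 : ℕ) + 1 : L) = ((n + 2 : ℕ) : L) + 1 by push_cast; ring]
    have h := norm_logTerm_le_pow_seven hϖ he (by rwa [norm_neg] : ‖-x‖ ≤ ‖(ϖ : L)‖ ^ 3)
      (by omega : 2 ≤ n + 2)
    simpa using h
  have h01 : ∑ i ∈ Finset.range 2, f i = x - x ^ 2 / 2 := by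
    rw [Finset.sum_range_succ, Finset.sum_range_succ, Finset.sum_range_zero, zero_add]
    simp only [hfdef, sub_add_cancel_left]
    push_cast
    ring
  rw [h01] at hT
  exact hT

/-- **H3 PROVED.**  For anti-invariant `z ∈ 𝔭`: `log₂(1+2z) − σ log₂(1+2z) − 4z = T − σT` where `T` is
the third-order remainder of `log₂(1 + 2z)` (the quadratic term `−2z²` is `σ`-fixed), so its norm is
`≤ ‖ϖ‖⁷`. -/
theorem hThree_holds {ϖ : Lˣ} (hϖ : IsUniformizer ϖ) (he : absRamificationIdx 2 L = 2) : HThree σ ϖ := by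
  intro z hzσ hzn
  have hρ2 : ‖(ϖ : L)‖ ^ 2 = ‖(2 : L)‖ := WildQuadraticDyadic.norm_unif_sq_eq_norm_two hϖ he
  have hx : ‖(2 : L) * z‖ ≤ ‖(ϖ : L)‖ ^ 3 := by
    rw [norm_mul, ← hρ2]
    calc ‖(ϖ : L)‖ ^ 2 * ‖z‖ ≤ ‖(ϖ : L)‖ ^ 2 * ‖(ϖ : L)‖ := by gcongr
      _ = ‖(ϖ : L)‖ ^ 3 := by ring
  have hT := norm_unitLog_sub_quadratic_le hϖ he hx
  set T : L := unitLog (1 + 2 * z) - (2 * z - (2 * z) ^ 2 / 2) with hTdef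
  have hσq : σ (2 * z - (2 * z) ^ 2 / 2) = -(2 * z) - (2 * z) ^ 2 / 2 := by
    rw [map_sub, map_div₀, map_pow, map_mul, map_ofNat, hzσ]; ring
  have hu : unitLog (1 + 2 * z) = T + (2 * z - (2 * z) ^ 2 / 2) := by rw [hTdef]; ring
  have hσu : σ (unitLog (1 + 2 * z)) = σ T + (-(2 * z) - (2 * z) ^ 2 / 2) := by
    rw [hu, map_add, hσq]
  have hid : (unitLog (1 + 2 * z) - σ (unitLog (1 + 2 * z))) - 4 * z = T - σ T := by
    rw [hσu, hu]; ring
  rw [hid]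
  calc ‖T - σ T‖ ≤ max ‖T‖ ‖σ T‖ := norm_sub_le_max' _ _
    _ = ‖T‖ := by rw [norm_map_sigma, max_self]
    _ ≤ ‖(ϖ : L)‖ ^ 7 := hT

/-- **LOWER half (S2c, PROVED modulo H3):** every `w` with `σw = −w`, `‖w‖ ≤ ‖ϖ‖³` is `(1 − σ)` of a
log-unit: with `x = 1 + w/2`, `x² = (1 + w²/4)(1 + 2z)`, `z = (w/2)/(1 + w²/4)`,
`(1 − σ)log₂ x = w/(1 + w²/4) + r/2 ≡ w (mod ‖ϖ‖⁵)` and the defect `d` is repaired by `d/2 ∈ 𝔭³ ⊆ log₂𝒪ˣ`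
(tree U1 `WildQuadraticDyadic.closedBall_subset_logUnits`). -/
theorem antiBall_subset_asymLogUnits (hσ2 : ∀ x : L, σ (σ x) = x) {ϖ : Lˣ} (hϖ : IsUniformizer ϖ)
    (he : absRamificationIdx 2 L = 2) (H : HThree σ ϖ) :
    antiBall σ (‖(ϖ : L)‖ ^ 3) ⊆ asymLogUnits σ := by
  rintro w ⟨hwσ, hwn⟩
  -- numerology at `e = 2`
  have hρ2 : ‖(ϖ : L)‖ ^ 2 = ‖(2 : L)‖ := WildQuadraticDyadic.norm_unif_sq_eq_norm_two hϖ he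
  have hρpos : 0 < ‖(ϖ : L)‖ := norm_pos_iff.mpr ϖ.ne_zero
  have hρ1 : ‖(ϖ : L)‖ < 1 := hϖ.1
  have h20 : (2 : L) ≠ 0 := two_ne_zero'
  have h2pos : 0 < ‖(2 : L)‖ := norm_pos_iff.mpr h20
  -- `h = w/2`, `x = 1 + h`
  set h : L := w / 2 with hh
  have hhσ : σ h = -h := by rw [hh, map_div₀, hwσ, map_ofNat, neg_div]
  have hhn : ‖h‖ ≤ ‖(ϖ : L)‖ := by
    rw [hh, norm_div, ← hρ2, div_le_iff₀ (by positivity)]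
    calc ‖w‖ ≤ ‖(ϖ : L)‖ ^ 3 := hwn
      _ = ‖(ϖ : L)‖ * ‖(ϖ : L)‖ ^ 2 := by ring
  set x : L := 1 + h with hx
  have hxP : ‖1 - x‖ < 1 := by
    rw [hx, sub_add_cancel_left, norm_neg]; exact hhn.trans_lt hρ1
  have hx1 : ‖x‖ = 1 := IsPrincipal.norm_eq_one hxP
  -- `c = 1 + h²` is `σ`-fixed, principal
  set c : L := 1 + h ^ 2 with hc
  have hcσ : σ c = c := by rw [hc, map_add, map_one, map_pow, hhσ, neg_sq]
  have hh2n : ‖h ^ 2‖ ≤ ‖(ϖ : L)‖ ^ 2 := by rw [norm_pow]; gcongr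
  have hcP : ‖1 - c‖ < 1 := by
    rw [hc, sub_add_cancel_left, norm_neg]
    exact hh2n.trans_lt (by nlinarith)
  have hc1 : ‖c‖ = 1 := IsPrincipal.norm_eq_one hcP
  have hc0 : c ≠ 0 := norm_pos_iff.mp (by rw [hc1]; exact one_pos)
  -- `z = h/c` anti-invariant in `𝔭`
  set z : L := h / c with hz
  have hzσ : σ z = -z := by rw [hz, map_div₀, hhσ, hcσ, neg_div]
  have hzn : ‖z‖ ≤ ‖(ϖ : L)‖ := by rw [hz, norm_div, hc1, div_one]; exact hhn
  have h2zn : ‖1 - (1 + 2 * z)‖ < 1 := by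
    rw [sub_add_cancel_left, norm_neg, norm_mul, ← hρ2]
    calc ‖(ϖ : L)‖ ^ 2 * ‖z‖ ≤ ‖(ϖ : L)‖ ^ 2 * 1 := by
          gcongr; exact hzn.trans hρ1.le
      _ < 1 := by nlinarith
  have h12z1 : ‖1 + 2 * z‖ = 1 := IsPrincipal.norm_eq_one h2zn
  -- the squaring identity `x² = c·(1 + 2z)`
  have hc0' : (1 : L) + h ^ 2 ≠ 0 := by rw [← hc]; exact hc0
  have hx2 : x ^ 2 = c * (1 + 2 * z) := by
    rw [hz, hx, hc]
    field_simp
    ring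
  -- `2·log₂ x = log₂ c + log₂(1 + 2z)`
  have hlog2 : (2 : L) * unitLog x = unitLog c + unitLog (1 + 2 * z) := by
    have h := unitLog_pow 2 hx1 2
    rw [hx2, unitLog_mul 2 hc1 h12z1] at h
    push_cast at h
    exact h.symm
  have hasymc : unitLog c - σ (unitLog c) = 0 := by rw [← unitLog_map_sigma, hcσ, sub_self]
  -- H3 remainder
  have H3 := H z hzσ hzn
  set r : L := (unitLog (1 + 2 * z) - σ (unitLog (1 + 2 * z))) - 4 * z with hr
  have e1 : (2 : L) * (unitLog x - σ (unitLog x)) =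
      (unitLog c - σ (unitLog c)) + (unitLog (1 + 2 * z) - σ (unitLog (1 + 2 * z))) := by
    have hσ2x : σ ((2 : L) * unitLog x) = 2 * σ (unitLog x) := by rw [map_mul, map_ofNat]
    calc (2 : L) * (unitLog x - σ (unitLog x)) = 2 * unitLog x - σ (2 * unitLog x) := by
          rw [hσ2x]; ring
      _ = _ := by rw [hlog2, map_add]; ring
  have hasymx : unitLog x - σ (unitLog x) = w / c + r / 2 := by
    apply mul_left_cancel₀ h20
    rw [e1, hasymc, zero_add]
    have h' : unitLog (1 + 2 * z) - σ (unitLog (1 + 2 * z)) = r + 4 * z := by rw [hr]; ring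
    rw [h', hz, hh]
    field_simp
    ring
  -- the defect `d = (1 − σ)log₂ x − w`, `‖d‖ ≤ ‖ϖ‖⁵`, anti-invariant
  set d : L := (unitLog x - σ (unitLog x)) - w with hd
  have hdval : d = -(w * h ^ 2 / c) + r / 2 := by
    rw [hd, hasymx]
    field_simp
    rw [hc]
    ring
  have hdn : ‖d‖ ≤ ‖(ϖ : L)‖ ^ 5 := by
    rw [hdval]
    refine (IsUltrametricDist.norm_add_le_max _ _).trans (max_le ?_ ?_)
    · rw [norm_neg, norm_div, hc1, div_one, norm_mul]
      calc ‖w‖ * ‖h ^ 2‖ ≤ ‖(ϖ : L)‖ ^ 3 * ‖(ϖ : L)‖ ^ 2 := by gcongr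
        _ = ‖(ϖ : L)‖ ^ 5 := by ring
    · rw [norm_div, ← hρ2, div_le_iff₀ (by positivity)]
      calc ‖r‖ ≤ ‖(ϖ : L)‖ ^ 7 := H3
        _ = ‖(ϖ : L)‖ ^ 5 * ‖(ϖ : L)‖ ^ 2 := by ring
  have hdσ : σ d = -d := by
    rw [hd, map_sub, map_sub, hσ2, hwσ]
    ring
  -- repair: `z₀ = d/2 ∈ 𝔭³ ⊆ log₂(𝒪ˣ)` (tree U1)
  set z₀ : L := d / 2 with hz₀
  have hz₀n : ‖z₀‖ ≤ ‖(ϖ : L)‖ ^ 3 := by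
    rw [hz₀, norm_div, ← hρ2, div_le_iff₀ (by positivity)]
    calc ‖d‖ ≤ ‖(ϖ : L)‖ ^ 5 := hdn
      _ = ‖(ϖ : L)‖ ^ 3 * ‖(ϖ : L)‖ ^ 2 := by ring
  have hz₀L : z₀ ∈ logUnits L :=
    WildQuadraticDyadic.closedBall_subset_logUnits hϖ he (mem_closedBall_zero_iff.mpr hz₀n)
  have hz₀σ : z₀ - σ z₀ = d := by
    rw [hz₀, map_div₀, map_ofNat, hdσ]
    field_simp
    ring
  have hlogx : unitLog x ∈ logUnits L := unitLog_mem_logUnits hx1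
  refine ⟨unitLog x - z₀, (logUnitsAddSubgroup 2 L).sub_mem hlogx hz₀L, ?_⟩
  have hxd : unitLog x - σ (unitLog x) = d + w := by rw [hd]; ring
  show (unitLog x - z₀) - σ (unitLog x - z₀) = w
  rw [map_sub]
  linear_combination hxd - hz₀σ

/-- **`(1 − σ)·log₂(𝒪_Lˣ) = antiBall σ ‖ϖ‖³` (PROVED modulo H3).** -/
theorem asymLogUnits_eq_antiBall (hσ2 : ∀ x : L, σ (σ x) = x)
    (hres : ∀ z : L, ‖z‖ ≤ 1 → ∃ a : L, σ a = a ∧ ‖z - a‖ < 1)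
    {ϖ : Lˣ} (hϖ : IsUniformizer ϖ) (he : absRamificationIdx 2 L = 2)
    (hanti : σ (ϖ : L) = -(ϖ : L)) (H : HThree σ ϖ) :
    asymLogUnits σ = antiBall σ (‖(ϖ : L)‖ ^ 3) :=
  Subset.antisymm (asymLogUnits_subset_antiBall σ hσ2 hres hϖ he hanti)
    (antiBall_subset_asymLogUnits σ hσ2 hϖ he H)

/-! ## §4 KEYED LAW at conductor 8 (`u ∈ {±2, ±6}`, every layer): glue PROVED -/

omit [IsUltrametricDist L] [ProperSpace L] in
/-- At conductor 8 the uniformizer class is `ζ = ϖ/σϖ = −1`, torsion of order `2`. -/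
theorem zeta_torsion_of_anti {ϖ : Lˣ} (hanti : σ (ϖ : L) = -(ϖ : L)) :
    ∃ n : ℕ, 0 < n ∧ ((ϖ : L) * (σ (ϖ : L))⁻¹) ^ n = 1 := by
  refine ⟨2, two_pos, ?_⟩
  rw [hanti, inv_neg, mul_neg, mul_inv_cancel₀ ϖ.ne_zero, neg_one_sq]

/-- **KEYED LAW, conductor-8 keys (DECOMPOSITION GLUE, PROVED modulo the typed hand step H3):**
for a `2`-adic field `L` with `e = 2`, an involution `σ` with `k_L = k_{L^σ}` and a uniformizer with
`σϖ = −ϖ` — i.e. every layer `L_n = F_n(√u)`, `u ∈ {±2, ±6}`, `ϖ = √u` —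
`log₂(U¹(L)^{N=1}) = {w | σw = −w, ‖w‖ ≤ ‖2ϖ‖}`. -/
theorem keyedLawEight_of_HThree (hσ2 : ∀ x : L, σ (σ x) = x)
    (hres : ∀ z : L, ‖z‖ ≤ 1 → ∃ a : L, σ a = a ∧ ‖z - a‖ < 1)
    {ϖ : Lˣ} (hϖ : IsUniformizer ϖ) (he : absRamificationIdx 2 L = 2)
    (hanti : σ (ϖ : L) = -(ϖ : L)) (H : HThree σ ϖ) :
    unitLog '' normOnePrincipal σ = antiBall σ (‖(ϖ : L)‖ ^ 3) := by
  rw [image_normOnePrincipal_eq_asymLogUnits σ hσ2 (norm_sigma_sub_lt_one σ hres) hϖ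
      (zeta_torsion_of_anti σ hanti),
    asymLogUnits_eq_antiBall σ hσ2 hres hϖ he hanti H]

/-- **The table form `2√u·𝒪_{F_n}` (PROVED):** `antiBall σ ‖ϖ‖³ = (2ϖ)·𝒪_F`. -/
theorem antiBall_eq_smul_fixedBall {ϖ : Lˣ} (hϖ : IsUniformizer ϖ) (he : absRamificationIdx 2 L = 2)
    (hanti : σ (ϖ : L) = -(ϖ : L)) :
    antiBall σ (‖(ϖ : L)‖ ^ 3) = ((2 : L) * (ϖ : L)) • fixedBall σ 1 := by
  have hρ2 : ‖(ϖ : L)‖ ^ 2 = ‖(2 : L)‖ := WildQuadraticDyadic.norm_unif_sq_eq_norm_two hϖ he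
  have hρpos : 0 < ‖(ϖ : L)‖ := norm_pos_iff.mpr ϖ.ne_zero
  have h2ϖ0 : (2 : L) * (ϖ : L) ≠ 0 := mul_ne_zero two_ne_zero' ϖ.ne_zero
  have hn2ϖ : ‖(2 : L) * (ϖ : L)‖ = ‖(ϖ : L)‖ ^ 3 := by rw [norm_mul, ← hρ2]; ring
  ext w
  constructor
  · rintro ⟨hwσ, hwn⟩
    refine Set.mem_smul_set.mpr ⟨w / (2 * (ϖ : L)), ⟨?_, ?_⟩, ?_⟩
    · rw [map_div₀, map_mul, map_ofNat, hwσ, hanti, mul_neg, neg_div_neg_eq]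
    · rw [norm_div, hn2ϖ]
      exact div_le_one_of_le₀ hwn (by positivity)
    · rw [smul_eq_mul, mul_div_cancel₀ _ h2ϖ0]
  · intro hw
    obtain ⟨a, ⟨haσ, han⟩, rfl⟩ := Set.mem_smul_set.mp hw
    refine ⟨?_, ?_⟩
    · rw [smul_eq_mul, map_mul, map_mul, map_ofNat, hanti, haσ]; ring
    · rw [smul_eq_mul, norm_mul, hn2ϖ]
      exact mul_le_of_le_one_right (by positivity) han

/-- **KEYED LAW, conductor 8, table form (PROVED modulo H3):** `log₂(U¹(L_n)^{N=1}) = 2ϖ·𝒪_{F_n}`. -/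
theorem keyedLawEight_table_of_HThree (hσ2 : ∀ x : L, σ (σ x) = x)
    (hres : ∀ z : L, ‖z‖ ≤ 1 → ∃ a : L, σ a = a ∧ ‖z - a‖ < 1)
    {ϖ : Lˣ} (hϖ : IsUniformizer ϖ) (he : absRamificationIdx 2 L = 2)
    (hanti : σ (ϖ : L) = -(ϖ : L)) (H : HThree σ ϖ) :
    unitLog '' normOnePrincipal σ = ((2 : L) * (ϖ : L)) • fixedBall σ 1 := by
  rw [keyedLawEight_of_HThree σ hσ2 hres hϖ he hanti H, antiBall_eq_smul_fixedBall σ hϖ he hanti]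

/-- **KEYED LAW, conductor-8 keys — PROVED (H3 discharged by `hThree_holds`).**  For every `2`-adic
field `L` with `e(L/ℚ₂) = 2`, every involution `σ ∈ Aut(L/ℚ₂)` with `k_L = k_{L^σ}` and every uniformizer
with `σϖ = −ϖ`: `log₂(U¹(L)^{N_σ = 1}) = {w | σw = −w, ‖w‖ ≤ ‖2ϖ‖}`.  This is the entry
`log₂ H¹(F_n, T(key)) = 2√u·𝒪_{F_n}` of STUB-PLAN §3 (xxiv) for `u ∈ {±2, ±6}` and ALL `n ≥ 0`
(`L = L_n = F_n(√u)`, `F_n/ℚ₂` unramified, `ϖ = √u` or `√u/…` any uniformizer with `σϖ = −ϖ`). -/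
theorem keyedLawEight (hσ2 : ∀ x : L, σ (σ x) = x)
    (hres : ∀ z : L, ‖z‖ ≤ 1 → ∃ a : L, σ a = a ∧ ‖z - a‖ < 1)
    {ϖ : Lˣ} (hϖ : IsUniformizer ϖ) (he : absRamificationIdx 2 L = 2)
    (hanti : σ (ϖ : L) = -(ϖ : L)) :
    unitLog '' normOnePrincipal σ = antiBall σ (‖(ϖ : L)‖ ^ 3) :=
  keyedLawEight_of_HThree σ hσ2 hres hϖ he hanti (hThree_holds σ hϖ he)

/-- **KEYED LAW, conductor 8, table form — PROVED:** `log₂(U¹(L_n)^{N=1}) = 2ϖ·𝒪_{F_n}`. -/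
theorem keyedLawEight_table (hσ2 : ∀ x : L, σ (σ x) = x)
    (hres : ∀ z : L, ‖z‖ ≤ 1 → ∃ a : L, σ a = a ∧ ‖z - a‖ < 1)
    {ϖ : Lˣ} (hϖ : IsUniformizer ϖ) (he : absRamificationIdx 2 L = 2)
    (hanti : σ (ϖ : L) = -(ϖ : L)) :
    unitLog '' normOnePrincipal σ = ((2 : L) * (ϖ : L)) • fixedBall σ 1 :=
  keyedLawEight_table_of_HThree σ hσ2 hres hϖ he hanti (hThree_holds σ hϖ he)

/-- **`(1 − σ)·log₂(𝒪_Lˣ) = 2ϖ·𝒪_F` — PROVED** (the `S`-image half on its own, in the shape the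
index budget of §3 (xiv′) consumes). -/
theorem asymLogUnits_eq_table (hσ2 : ∀ x : L, σ (σ x) = x)
    (hres : ∀ z : L, ‖z‖ ≤ 1 → ∃ a : L, σ a = a ∧ ‖z - a‖ < 1)
    {ϖ : Lˣ} (hϖ : IsUniformizer ϖ) (he : absRamificationIdx 2 L = 2)
    (hanti : σ (ϖ : L) = -(ϖ : L)) :
    asymLogUnits σ = ((2 : L) * (ϖ : L)) • fixedBall σ 1 := by
  rw [asymLogUnits_eq_antiBall σ hσ2 hres hϖ he hanti (hThree_holds σ hϖ he),
    antiBall_eq_smul_fixedBall σ hϖ he hanti]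

/-! ## §5 Conductor-4 keys (`u ∈ {−1, 3}`, `i ∈ L`) and the exception `(3, 0)`: glue PROVED -/

/-- **IMLAW at conductor 4:** `(1 − σ)·log₂(𝒪_Lˣ) = 2i·AS(F)` — the Artin–Schreier bit `j = c = 1`;
PROVED over the conductor-4 frame in §6 (`CondFourFrame.imLawFour`). -/
def ImLawFour (σ : L ≃ₐ[ℚ_[2]] L) (I : L) : Prop :=
  asymLogUnits σ = ((2 : L) * I) • artinSchreierBall σ

omit [IsUltrametricDist L] [ProperSpace L] in
/-- At conductor 4 (`ϖ = 1 + i`, `σ i = −i`) the uniformizer class is `ζ = (1+i)/(1−i) = i`, torsion of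
order `4`. -/
theorem zeta_torsion_of_one_add_I {ϖ : Lˣ} {I : L} (hI : I ^ 2 = -1) (hσI : σ I = -I)
    (hϖI : (ϖ : L) = 1 + I) :
    ∃ n : ℕ, 0 < n ∧ ((ϖ : L) * (σ (ϖ : L))⁻¹) ^ n = 1 := by
  have h1I : (1 : L) + -I ≠ 0 := by
    intro h0
    have hI1 : I = 1 := by linear_combination -h0
    rw [hI1, one_pow] at hI
    exact two_ne_zero' (by linear_combination hI)
  have key : (1 + I) * ((1 : L) + -I)⁻¹ = I := by
    rw [mul_inv_eq_iff_eq_mul₀ h1I]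
    linear_combination hI
  refine ⟨4, by norm_num, ?_⟩
  rw [hϖI, map_add, map_one, hσI, key, show (4 : ℕ) = 2 * 2 from rfl, pow_mul, hI, neg_one_sq]

/-- **KEYED LAW, conductor-4 keys (GLUE PROVED):** SEAM + `ImLawFour` give
`log₂(U¹(L)^{N=1}) = 2i·AS(F)` (the table entry `2i·AS_n`); unconditional form: `CondFourFrame.keyedLawFour`. -/
theorem keyedLawFour_of_ImLawFour (hσ2 : ∀ x : L, σ (σ x) = x)
    (hσres : ∀ x : L, ‖x‖ ≤ 1 → ‖σ x - x‖ < 1) {ϖ : Lˣ} (hϖ : IsUniformizer ϖ)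
    {I : L} (hI : I ^ 2 = -1) (hσI : σ I = -I) (hϖI : (ϖ : L) = 1 + I) (H : ImLawFour σ I) :
    unitLog '' normOnePrincipal σ = ((2 : L) * I) • artinSchreierBall σ := by
  rw [image_normOnePrincipal_eq_asymLogUnits σ hσ2 hσres hϖ (zeta_torsion_of_one_add_I σ hI hσI hϖI)]
  exact H

/-- **The exception `(u, n) = (3, 0)` (TYPED target):** when `ζ = ϖ/σϖ` is NOT torsion
(`L = ℚ₂(√3)`, `ϖ = √3 − 1`, `ζ = −(2 − √3)`, `‖log₂ ζ‖ = ‖2‖`) the seam carries the unit class: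
`log₂(U¹(L)^{N=1}) = (1 − σ)log₂𝒪ˣ ∪ (log₂ ζ + (1 − σ)log₂𝒪ˣ)` (`2·log₂ ζ = (1 − σ)log₂ ζ` lies in the
lattice), whence the table entry `2√3ℤ₂ = 4√3ℤ₂ ∪ (log₂ ζ + 4√3ℤ₂)`. -/
def SeamWithUnitClass (σ : L ≃ₐ[ℚ_[2]] L) (ϖ : Lˣ) : Prop :=
  unitLog '' normOnePrincipal σ =
    asymLogUnits σ ∪ ((fun w : L => unitLog ((ϖ : L) * (σ (ϖ : L))⁻¹) + w) '' asymLogUnits σ)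

end Sigma

/-! ## §6 Conductor-4 keys: the Artin–Schreier law PROVED

For the keys `u ∈ {−1, 3}` the layer `L_n = F_n(√u)` contains `i` (all `n` for `u = −1`; `n ≥ 1` for
`u = 3`), `ϖ = 1 + i` is a uniformizer, `σ i = −i`, `σϖ = −iϖ`, lower break `i(σ) = 2` (conductor 4).  The
frame below records exactly this; over it `(1 − σ)·log₂(𝒪_Lˣ) = 2i·AS(F)` and hence (SEAM, `ζ = i`)
`log₂(U¹(L)^{N=1}) = 2i·AS(F)` are PROVED — the table entries `2i·AS_n` of STUB-PLAN §3 (xxiv). -/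

section Four

variable {σ : L ≃ₐ[ℚ_[2]] L}

theorem add_mem_asymLogUnits {a b : L} (ha : a ∈ asymLogUnits σ) (hb : b ∈ asymLogUnits σ) :
    a + b ∈ asymLogUnits σ := by
  obtain ⟨z, hz, rfl⟩ := ha
  obtain ⟨z', hz', rfl⟩ := hb
  refine ⟨z + z', (logUnitsAddSubgroup 2 L).add_mem hz hz', ?_⟩
  show (z + z') - σ (z + z') = (z - σ z) + (z' - σ z')
  rw [map_add]; ring

theorem sub_mem_asymLogUnits {a b : L} (ha : a ∈ asymLogUnits σ) (hb : b ∈ asymLogUnits σ) :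
    a - b ∈ asymLogUnits σ := by
  obtain ⟨z, hz, rfl⟩ := ha
  obtain ⟨z', hz', rfl⟩ := hb
  refine ⟨z - z', (logUnitsAddSubgroup 2 L).sub_mem hz hz', ?_⟩
  show (z - z') - σ (z - z') = (z - σ z) - (z' - σ z')
  rw [map_sub]; ring

omit [IsUltrametricDist L] [ProperSpace L] in
theorem unitLog_sub_mem_asymLogUnits {u : L} (hu : ‖u‖ = 1) :
    unitLog u - σ (unitLog u) ∈ asymLogUnits σ :=
  ⟨unitLog u, unitLog_mem_logUnits hu, rfl⟩

/-- Small anti-invariant elements lie in the lattice: `σE = −E`, `‖E‖ ≤ ‖ϖ‖⁵` ⇒ `E = (1 − σ)(E/2)` with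
`E/2 ∈ 𝔭³ ⊆ log₂(𝒪ˣ)` (tree U1). -/
theorem mem_asymLogUnits_of_norm_le {ϖ : Lˣ} (hϖ : IsUniformizer ϖ) (he : absRamificationIdx 2 L = 2)
    {E : L} (hE : σ E = -E) (hEn : ‖E‖ ≤ ‖(ϖ : L)‖ ^ 5) : E ∈ asymLogUnits σ := by
  have hρ2 := WildQuadraticDyadic.norm_unif_sq_eq_norm_two hϖ he
  have hρpos : 0 < ‖(ϖ : L)‖ := norm_pos_iff.mpr ϖ.ne_zero
  have h20 : (2 : L) ≠ 0 := two_ne_zero'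
  refine ⟨E / 2, WildQuadraticDyadic.closedBall_subset_logUnits hϖ he
    (mem_closedBall_zero_iff.mpr ?_), ?_⟩
  · rw [norm_div, ← hρ2, div_le_iff₀ (by positivity)]
    calc ‖E‖ ≤ ‖(ϖ : L)‖ ^ 5 := hEn
      _ = ‖(ϖ : L)‖ ^ 3 * ‖(ϖ : L)‖ ^ 2 := by ring
  · show E / 2 - σ (E / 2) = E
    rw [map_div₀, map_ofNat, hE]
    field_simp
    ring

/-- **The conductor-4 frame** (keys `u ∈ {−1, 3}`, `i ∈ L`): an involution `σ` of the `2`-adic field `L`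
(`e = 2`) acting trivially on the residue field, an element `I` with `I² = −1`, `σI = −I`, and the
uniformizer `ϖ = 1 + I`. -/
structure CondFourFrame (σ : L ≃ₐ[ℚ_[2]] L) (ϖ : Lˣ) (I : L) : Prop where
  invol : ∀ x : L, σ (σ x) = x
  res : ∀ z : L, ‖z‖ ≤ 1 → ∃ a : L, σ a = a ∧ ‖z - a‖ < 1
  unif : IsUniformizer ϖ
  ram : absRamificationIdx 2 L = 2
  sq_I : I ^ 2 = -1
  sigma_I : σ I = -I
  unif_eq : (ϖ : L) = 1 + I

namespace CondFourFrame

variable {ϖ : Lˣ} {I : L}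

theorem rho_sq (h : CondFourFrame σ ϖ I) : ‖(ϖ : L)‖ ^ 2 = ‖(2 : L)‖ :=
  WildQuadraticDyadic.norm_unif_sq_eq_norm_two h.unif h.ram

theorem norm_I (h : CondFourFrame σ ϖ I) : ‖I‖ = 1 := by
  have h2 : ‖I‖ ^ 2 = 1 := by rw [← norm_pow, h.sq_I, norm_neg, norm_one]
  exact (pow_eq_one_iff_of_nonneg (norm_nonneg I) two_ne_zero).mp h2

theorem I_ne_zero (h : CondFourFrame σ ϖ I) : I ≠ 0 :=
  norm_pos_iff.mp (by rw [h.norm_I]; exact one_pos)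

/-- `σϖ = −iϖ`. -/
theorem sigma_unif (h : CondFourFrame σ ϖ I) : σ (ϖ : L) = -I * ϖ := by
  rw [h.unif_eq, map_add, map_one, h.sigma_I]
  linear_combination h.sq_I

/-- `ϖ² = 2i`. -/
theorem unif_sq (h : CondFourFrame σ ϖ I) : (ϖ : L) ^ 2 = 2 * I := by
  rw [h.unif_eq]; linear_combination h.sq_I

/-- The lower break is `2`: `‖σϖ − ϖ‖ = ‖ϖ²‖ = ‖2‖` (conductor 4). -/
theorem norm_sigma_unif_sub (h : CondFourFrame σ ϖ I) : ‖σ (ϖ : L) - ϖ‖ = ‖(ϖ : L)‖ ^ 2 := by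
  have e : σ (ϖ : L) - ϖ = -((ϖ : L) ^ 2) := by
    rw [h.sigma_unif]
    linear_combination (ϖ : L) * h.unif_eq
  rw [e, norm_neg, norm_pow]

/-- **TRI at conductor 4 (PROVED):** `‖σz − z‖ ≤ ‖ϖ‖² = ‖2‖` on `𝒪_L`. -/
theorem norm_sigma_sub_le (h : CondFourFrame σ ϖ I) (z : L) (hz : ‖z‖ ≤ 1) :
    ‖σ z - z‖ ≤ ‖(ϖ : L)‖ ^ 2 := by
  have hρpos : 0 < ‖(ϖ : L)‖ := norm_pos_iff.mpr ϖ.ne_zero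
  have hρ1 : ‖(ϖ : L)‖ < 1 := h.unif.1
  have hρ21 : ‖(ϖ : L)‖ ^ 2 ≤ ‖(ϖ : L)‖ ^ 1 := pow_le_pow_of_le_one hρpos.le hρ1.le (by norm_num)
  have h1 : ∀ z : L, ‖z‖ ≤ 1 → ‖σ z - z‖ ≤ ‖(ϖ : L)‖ := norm_sigma_sub_le_unif σ h.res h.unif
  have h2 := norm_sigma_sub_le_step σ h.res h.unif h1 z hz
  rwa [h.norm_sigma_unif_sub, show ‖(ϖ : L)‖ * ‖(ϖ : L)‖ = ‖(ϖ : L)‖ ^ 2 by ring, max_self] at h2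

/-- **No odd valuations in the fixed field (PROVED):** `σa = a`, `‖a‖ < 1` ⇒ `‖a‖ ≤ ‖ϖ‖²` — `L/L^σ` is
totally ramified because `σ` is residue-trivial yet moves `i` by `2i`: an `a ∈ L^σ` of norm `‖ϖ‖` would
give `z₂ ∈ 𝒪_L` with `‖σz₂ − z₂‖ = 1` after two divisions by `a`. -/
theorem norm_le_sq_of_fixed (h : CondFourFrame σ ϖ I) {a : L} (ha : σ a = a) (ha1 : ‖a‖ < 1) :
    ‖a‖ ≤ ‖(ϖ : L)‖ ^ 2 := by
  by_cases hlt : ‖a‖ < ‖(ϖ : L)‖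
  · exact WildQuadraticDyadic.norm_le_sq_of_norm_lt_unif h.unif hlt
  exfalso
  have hρ2 := h.rho_sq
  have hρpos : 0 < ‖(ϖ : L)‖ := norm_pos_iff.mpr ϖ.ne_zero
  have haρ : ‖a‖ = ‖(ϖ : L)‖ := le_antisymm (h.unif.norm_le_of_norm_lt_one a ha1) (not_lt.mp hlt)
  have ha0 : a ≠ 0 := norm_pos_iff.mp (by rw [haρ]; exact hρpos)
  obtain ⟨a₀, ha₀σ, hIa₀⟩ := h.res I h.norm_I.le
  obtain ⟨z₁, hz₁⟩ : ∃ z₁ : L, z₁ = (I - a₀) / a := ⟨_, rfl⟩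
  have hz₁n : ‖z₁‖ ≤ 1 := by
    rw [hz₁, norm_div, haρ]
    exact div_le_one_of_le₀ (h.unif.norm_le_of_norm_lt_one _ hIa₀) hρpos.le
  have hz₁σ : z₁ - σ z₁ = 2 * I / a := by
    rw [hz₁, map_div₀, map_sub, h.sigma_I, ha₀σ, ha]; ring
  have hn₁ : ‖z₁ - σ z₁‖ = ‖(ϖ : L)‖ := by
    rw [hz₁σ, norm_div, norm_mul, h.norm_I, mul_one, ← hρ2, haρ, pow_two,
      mul_div_cancel_right₀ _ hρpos.ne']
  obtain ⟨a₁, ha₁σ, hza₁⟩ := h.res z₁ hz₁n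
  obtain ⟨z₂, hz₂⟩ : ∃ z₂ : L, z₂ = (z₁ - a₁) / a := ⟨_, rfl⟩
  have hz₂n : ‖z₂‖ ≤ 1 := by
    rw [hz₂, norm_div, haρ]
    exact div_le_one_of_le₀ (h.unif.norm_le_of_norm_lt_one _ hza₁) hρpos.le
  have hz₂σ : z₁ - σ z₁ = a * (z₂ - σ z₂) := by
    rw [hz₂, map_div₀, map_sub, ha₁σ, ha]
    field_simp
    ring
  have hn₂ : ‖z₂ - σ z₂‖ = 1 := by
    have e := hn₁
    rw [hz₂σ, norm_mul, haρ] at e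
    exact mul_left_cancel₀ hρpos.ne' (by rw [e, mul_one])
  have hlt1 := norm_sigma_sub_lt_one σ h.res z₂ hz₂n
  rw [norm_sub_rev, hn₂] at hlt1
  exact lt_irrefl _ hlt1

/-- **MAIN CONGRUENCE (PROVED):** for `y ∈ 𝒪_L`,
`(1 − σ)·log₂(1 + ϖy) ≡ 2i·y(1 + σy) (mod ‖ϖ‖³)`.  Proof: `(1 + ϖy)⁴ = 1 + 4n`, `n = m + m²`,
`m = ϖy + iy²`; the third-order expansion of `log₂(1 + 4n)` (`norm_unitLog_sub_quadratic_le`); TRI at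
conductor 4; and the identity `m − σm − 2iy(1 + σy) = −iϖ(y − σy) + i(y − σy)²`. -/
theorem norm_asym_sub_le (h : CondFourFrame σ ϖ I) {y : L} (hy : ‖y‖ ≤ 1) :
    ‖(unitLog (1 + (ϖ : L) * y) - σ (unitLog (1 + (ϖ : L) * y))) - 2 * I * y * (1 + σ y)‖
      ≤ ‖(ϖ : L)‖ ^ 3 := by
  have hρ2 := h.rho_sq
  have hρpos : 0 < ‖(ϖ : L)‖ := norm_pos_iff.mpr ϖ.ne_zero
  have hρ1 : ‖(ϖ : L)‖ < 1 := h.unif.1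
  have hI1 := h.norm_I
  have h4n : ‖(4 : L)‖ = ‖(ϖ : L)‖ ^ 4 := by
    rw [show (4 : L) = 2 ^ 2 by norm_num, norm_pow, ← hρ2]; ring
  have hσy1 : ‖σ y‖ ≤ 1 := by rw [norm_map_sigma]; exact hy
  have hδ : ‖y - σ y‖ ≤ ‖(ϖ : L)‖ ^ 2 := by rw [norm_sub_rev]; exact h.norm_sigma_sub_le y hy
  -- the unit `u = 1 + ϖ y`
  have hϖy : ‖(ϖ : L) * y‖ ≤ ‖(ϖ : L)‖ := by
    rw [norm_mul]; exact mul_le_of_le_one_right hρpos.le hy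
  have huP : ‖1 - (1 + (ϖ : L) * y)‖ < 1 := by
    rw [sub_add_cancel_left, norm_neg]; exact hϖy.trans_lt hρ1
  have hu1 : ‖1 + (ϖ : L) * y‖ = 1 := IsPrincipal.norm_eq_one huP
  -- `m = ϖy + iy²`, `n = m + m²`
  obtain ⟨m, hm⟩ : ∃ m : L, m = (ϖ : L) * y + I * y ^ 2 := ⟨_, rfl⟩
  obtain ⟨n, hn⟩ : ∃ n : L, n = m + m ^ 2 := ⟨_, rfl⟩
  have hm1 : ‖m‖ ≤ 1 := by
    rw [hm]
    refine (IsUltrametricDist.norm_add_le_max _ _).trans (max_le (hϖy.trans hρ1.le) ?_)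
    rw [norm_mul, hI1, one_mul, norm_pow]; exact pow_le_one₀ (norm_nonneg _) hy
  have hn1 : ‖n‖ ≤ 1 := by
    rw [hn]
    refine (IsUltrametricDist.norm_add_le_max _ _).trans (max_le hm1 ?_)
    rw [norm_pow]; exact pow_le_one₀ (norm_nonneg _) hm1
  have hσm : σ m = σ (ϖ : L) * σ y + σ I * σ y ^ 2 := by rw [hm, map_add, map_mul, map_mul, map_pow]
  have hσn : σ n = σ m + σ m ^ 2 := by rw [hn, map_add, map_pow]
  -- `u⁴ = 1 + x`, `x = 4n`
  obtain ⟨x, hx⟩ : ∃ x : L, x = 2 * (2 * n) := ⟨_, rfl⟩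
  have hu4 : (1 + (ϖ : L) * y) ^ 4 = 1 + x := by
    rw [hx, hn, hm]
    linear_combination (y ^ 2 * ((1 + (ϖ : L) * y) ^ 2 + 1 + 2 * ((ϖ : L) * y + I * y ^ 2))) * h.unif_sq
  have hxn : ‖x‖ ≤ ‖(ϖ : L)‖ ^ 3 := by
    rw [hx, norm_mul, norm_mul, ← hρ2]
    calc ‖(ϖ : L)‖ ^ 2 * (‖(ϖ : L)‖ ^ 2 * ‖n‖) ≤ ‖(ϖ : L)‖ ^ 2 * (‖(ϖ : L)‖ ^ 2 * 1) := by gcongr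
      _ = ‖(ϖ : L)‖ ^ 3 * ‖(ϖ : L)‖ := by ring
      _ ≤ ‖(ϖ : L)‖ ^ 3 * 1 := mul_le_mul_of_nonneg_left hρ1.le (by positivity)
      _ = ‖(ϖ : L)‖ ^ 3 := mul_one _
  -- third-order expansion of `log₂(1 + x)`
  obtain ⟨T, hT⟩ : ∃ T : L, T = unitLog (1 + x) - (x - x ^ 2 / 2) := ⟨_, rfl⟩
  have hTn : ‖T‖ ≤ ‖(ϖ : L)‖ ^ 7 := by rw [hT]; exact norm_unitLog_sub_quadratic_le h.unif h.ram hxn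
  have h4log : (4 : L) * unitLog (1 + (ϖ : L) * y) = T + (x - x ^ 2 / 2) := by
    have h4 := unitLog_pow 2 hu1 4
    push_cast at h4
    rw [← h4, hu4, hT]; ring
  have hσx : σ x = 2 * (2 * σ n) := by rw [hx, map_mul, map_mul, map_ofNat]
  have hσq : σ (x - x ^ 2 / 2) = σ x - σ x ^ 2 / 2 := by rw [map_sub, map_div₀, map_pow, map_ofNat]
  have h20 : (2 : L) ≠ 0 := two_ne_zero'
  have hx2 : x ^ 2 / 2 = 2 * (2 * n) ^ 2 := by rw [div_eq_iff h20, hx]; ring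
  have hσx2 : σ x ^ 2 / 2 = 2 * (2 * σ n) ^ 2 := by rw [div_eq_iff h20, hσx]; ring
  have h4A : (4 : L) * (unitLog (1 + (ϖ : L) * y) - σ (unitLog (1 + (ϖ : L) * y))) =
      (T - σ T) + 4 * (n - σ n) - 8 * ((n - σ n) * (n + σ n)) := by
    have hσ4 : σ ((4 : L) * unitLog (1 + (ϖ : L) * y)) = 4 * σ (unitLog (1 + (ϖ : L) * y)) := by
      rw [map_mul, map_ofNat]
    have e1 : (4 : L) * (unitLog (1 + (ϖ : L) * y) - σ (unitLog (1 + (ϖ : L) * y))) =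
        (T + (x - x ^ 2 / 2)) - σ (T + (x - x ^ 2 / 2)) := by
      rw [← h4log, hσ4]; ring
    rw [e1, map_add, hσq, hσx2, hx2, hσx, hx]; ring
  -- algebra
  have i1 : (n - σ n) - (m - σ m) = (m - σ m) * (m + σ m) := by rw [hσn, hn]; ring
  have i2 : (m - σ m) - 2 * I * y * (1 + σ y) = -I * (ϖ : L) * (y - σ y) + I * (y - σ y) ^ 2 := by
    rw [hσm, h.sigma_unif, h.sigma_I, hm, h.unif_eq]
    linear_combination y * h.sq_I
  -- bounds
  have hmσ : ‖m - σ m‖ ≤ ‖(ϖ : L)‖ ^ 2 := by rw [norm_sub_rev]; exact h.norm_sigma_sub_le m hm1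
  have hnσ : ‖n - σ n‖ ≤ ‖(ϖ : L)‖ ^ 2 := by rw [norm_sub_rev]; exact h.norm_sigma_sub_le n hn1
  have hmp : ‖m + σ m‖ ≤ ‖(ϖ : L)‖ ^ 2 := by
    rw [show m + σ m = 2 * m - (m - σ m) by ring]
    refine (norm_sub_le_max' _ _).trans (max_le ?_ hmσ)
    rw [norm_mul, ← hρ2]; exact mul_le_of_le_one_right (by positivity) hm1
  have hnp : ‖n + σ n‖ ≤ 1 :=
    (IsUltrametricDist.norm_add_le_max _ _).trans (max_le hn1 (by rw [norm_map_sigma]; exact hn1))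
  have B1 : ‖(n - σ n) - (m - σ m)‖ ≤ ‖(ϖ : L)‖ ^ 3 := by
    rw [i1, norm_mul]
    calc ‖m - σ m‖ * ‖m + σ m‖ ≤ ‖(ϖ : L)‖ ^ 2 * ‖(ϖ : L)‖ ^ 2 :=
          mul_le_mul hmσ hmp (norm_nonneg _) (by positivity)
      _ = ‖(ϖ : L)‖ ^ 3 * ‖(ϖ : L)‖ := by ring
      _ ≤ ‖(ϖ : L)‖ ^ 3 * 1 := mul_le_mul_of_nonneg_left hρ1.le (by positivity)
      _ = ‖(ϖ : L)‖ ^ 3 := mul_one _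
  have B2 : ‖(m - σ m) - 2 * I * y * (1 + σ y)‖ ≤ ‖(ϖ : L)‖ ^ 3 := by
    rw [i2]
    refine (IsUltrametricDist.norm_add_le_max _ _).trans (max_le ?_ ?_)
    · rw [norm_mul, norm_mul, norm_neg, hI1, one_mul]
      calc ‖(ϖ : L)‖ * ‖y - σ y‖ ≤ ‖(ϖ : L)‖ * ‖(ϖ : L)‖ ^ 2 := by gcongr
        _ = ‖(ϖ : L)‖ ^ 3 := by ring
    · rw [norm_mul, hI1, one_mul, norm_pow]
      calc ‖y - σ y‖ ^ 2 ≤ (‖(ϖ : L)‖ ^ 2) ^ 2 := by gcongr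
        _ = ‖(ϖ : L)‖ ^ 3 * ‖(ϖ : L)‖ := by ring
        _ ≤ ‖(ϖ : L)‖ ^ 3 * 1 := mul_le_mul_of_nonneg_left hρ1.le (by positivity)
        _ = ‖(ϖ : L)‖ ^ 3 := mul_one _
  have B3 : ‖(T - σ T) - 8 * ((n - σ n) * (n + σ n))‖ ≤ ‖(ϖ : L)‖ ^ 7 := by
    refine (norm_sub_le_max' _ _).trans (max_le ?_ ?_)
    · exact (norm_sub_le_max' _ _).trans (max_le hTn (by rw [norm_map_sigma]; exact hTn))
    · rw [norm_mul, norm_mul, show (8 : L) = 2 ^ 3 by norm_num, norm_pow, ← hρ2]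
      calc (‖(ϖ : L)‖ ^ 2) ^ 3 * (‖n - σ n‖ * ‖n + σ n‖)
          ≤ (‖(ϖ : L)‖ ^ 2) ^ 3 * (‖(ϖ : L)‖ ^ 2 * 1) :=
            mul_le_mul_of_nonneg_left (mul_le_mul hnσ hnp (norm_nonneg _) (by positivity))
              (by positivity)
        _ = ‖(ϖ : L)‖ ^ 7 * ‖(ϖ : L)‖ := by ring
        _ ≤ ‖(ϖ : L)‖ ^ 7 * 1 := mul_le_mul_of_nonneg_left hρ1.le (by positivity)
        _ = ‖(ϖ : L)‖ ^ 7 := mul_one _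
  -- assemble
  have key : (4 : L) * ((unitLog (1 + (ϖ : L) * y) - σ (unitLog (1 + (ϖ : L) * y)))
      - 2 * I * y * (1 + σ y)) =
      4 * ((n - σ n) - (m - σ m)) + 4 * ((m - σ m) - 2 * I * y * (1 + σ y))
        + ((T - σ T) - 8 * ((n - σ n) * (n + σ n))) := by
    rw [mul_sub, h4A]; ring
  have hfin : ‖(4 : L) * ((unitLog (1 + (ϖ : L) * y) - σ (unitLog (1 + (ϖ : L) * y)))
      - 2 * I * y * (1 + σ y))‖ ≤ ‖(ϖ : L)‖ ^ 7 := by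
    rw [key]
    refine (IsUltrametricDist.norm_add_le_max _ _).trans (max_le
      ((IsUltrametricDist.norm_add_le_max _ _).trans (max_le ?_ ?_)) B3)
    · rw [norm_mul, h4n]
      calc ‖(ϖ : L)‖ ^ 4 * ‖(n - σ n) - (m - σ m)‖ ≤ ‖(ϖ : L)‖ ^ 4 * ‖(ϖ : L)‖ ^ 3 := by gcongr
        _ = ‖(ϖ : L)‖ ^ 7 := by ring
    · rw [norm_mul, h4n]
      calc ‖(ϖ : L)‖ ^ 4 * ‖(m - σ m) - 2 * I * y * (1 + σ y)‖
          ≤ ‖(ϖ : L)‖ ^ 4 * ‖(ϖ : L)‖ ^ 3 := by gcongr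
        _ = ‖(ϖ : L)‖ ^ 7 := by ring
  rw [norm_mul, h4n] at hfin
  have hρ4 : 0 < ‖(ϖ : L)‖ ^ 4 := by positivity
  exact le_of_mul_le_mul_left (hfin.trans_eq (by ring)) hρ4

/-- **`(1 − σ)·log₂(𝒪_Lˣ) ⊆ 2i·AS(F)` (PROVED):** reduce to a principal unit by an odd power
(tree `exists_pow_isPrincipal_not_dvd`, `‖k⁻¹ − 1‖ ≤ ‖2‖`), write it `1 + ϖy`, and read the residue of
`b = (1 − σ)log₂ u/(2i) ≡ ℘(y) ≡ ℘(c)` off the main congruence (`c ∈ 𝒪_F` a residue representative of `y`). -/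
theorem asymLogUnits_subset_smul (h : CondFourFrame σ ϖ I) :
    asymLogUnits σ ⊆ ((2 : L) * I) • artinSchreierBall σ := by
  rintro _ ⟨w, hw, rfl⟩
  obtain ⟨u, hu1, rfl⟩ := mem_logUnits_iff.mp hw
  have hρ2 := h.rho_sq
  have hρpos : 0 < ‖(ϖ : L)‖ := norm_pos_iff.mpr ϖ.ne_zero
  have hρ1 : ‖(ϖ : L)‖ < 1 := h.unif.1
  have hI1 := h.norm_I
  have hI0 := h.I_ne_zero
  have h20 : (2 : L) ≠ 0 := two_ne_zero'
  have h2I0 : (2 : L) * I ≠ 0 := mul_ne_zero h20 hI0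
  have hn2I : ‖(2 : L) * I‖ = ‖(ϖ : L)‖ ^ 2 := by rw [norm_mul, hI1, mul_one, ← hρ2]
  have hσy1 : ∀ t : L, ‖σ t‖ = ‖t‖ := norm_map_sigma σ
  -- odd principal power `u^k = 1 + ϖ y`
  obtain ⟨k, hk, hk2, hkP⟩ := exists_pow_isPrincipal_not_dvd (p := 2) hu1
  have hkn : ‖(k : L)‖ = 1 := norm_natCast_eq_one_of_not_dvd 2 hk2
  have hk0 : (k : L) ≠ 0 := norm_pos_iff.mp (by rw [hkn]; exact one_pos)
  have hd : ‖u ^ k - 1‖ ≤ ‖(ϖ : L)‖ :=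
    h.unif.norm_le_of_norm_lt_one _ (by rw [norm_sub_rev]; exact hkP)
  obtain ⟨y, hy⟩ : ∃ y : L, y = (u ^ k - 1) / ϖ := ⟨_, rfl⟩
  have hyn : ‖y‖ ≤ 1 := by rw [hy, norm_div]; exact div_le_one_of_le₀ hd hρpos.le
  have hϖ0 : (ϖ : L) ≠ 0 := ϖ.ne_zero
  have huk : u ^ k = 1 + (ϖ : L) * y := by rw [hy]; field_simp; ring
  -- the main congruence for `u^k`, transported to `u`
  have main := h.norm_asym_sub_le hyn
  rw [← huk, unitLog_pow 2 hu1 k] at main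
  obtain ⟨A, hA⟩ : ∃ A : L, A = unitLog u - σ (unitLog u) := ⟨_, rfl⟩
  have hσA : σ A = -A := by rw [hA, map_sub, h.invol]; ring
  have hkA : (k : L) * unitLog u - σ ((k : L) * unitLog u) = k * A := by
    rw [map_mul, map_natCast, hA]; ring
  rw [hkA] at main
  -- a residue representative `c ∈ 𝒪_F` of `y`
  obtain ⟨c, hcσ, hyc⟩ := h.res y hyn
  have hc1 : ‖c‖ ≤ 1 := by
    rw [show c = y - (y - c) by ring]
    exact (norm_sub_le_max' _ _).trans (max_le hyn hyc.le)
  have hsy1 : ‖1 + σ y‖ ≤ 1 :=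
    (IsUltrametricDist.norm_add_le_max _ _).trans (max_le (by rw [norm_one]) (by rw [hσy1]; exact hyn))
  -- three small differences
  have e1 : ‖(k : L) * A / (2 * I) - y * (1 + σ y)‖ ≤ ‖(ϖ : L)‖ := by
    have e : (k : L) * A / (2 * I) - y * (1 + σ y) = ((k : L) * A - 2 * I * y * (1 + σ y)) / (2 * I) := by
      field_simp
    rw [e, norm_div, hn2I, div_le_iff₀ (by positivity)]
    calc ‖(k : L) * A - 2 * I * y * (1 + σ y)‖ ≤ ‖(ϖ : L)‖ ^ 3 := main
      _ = ‖(ϖ : L)‖ * ‖(ϖ : L)‖ ^ 2 := by ring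
  have e2 : ‖y * (1 + σ y) - (c ^ 2 + c)‖ < 1 := by
    have e : y * (1 + σ y) - (c ^ 2 + c) = (y - c) * (1 + σ y) + c * σ (y - c) := by
      rw [map_sub, hcσ]; ring
    rw [e]
    refine (IsUltrametricDist.norm_add_le_max _ _).trans_lt (max_lt ?_ ?_)
    · rw [norm_mul]
      calc ‖y - c‖ * ‖1 + σ y‖ ≤ ‖y - c‖ * 1 := by gcongr
        _ < 1 := by rw [mul_one]; exact hyc
    · rw [norm_mul, hσy1]
      calc ‖c‖ * ‖y - c‖ ≤ 1 * ‖y - c‖ := by gcongr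
        _ < 1 := by rw [one_mul]; exact hyc
  have hbk1 : ‖(k : L) * A / (2 * I)‖ ≤ 1 := by
    rw [show (k : L) * A / (2 * I) = ((k : L) * A / (2 * I) - y * (1 + σ y)) + y * (1 + σ y) by ring]
    refine (IsUltrametricDist.norm_add_le_max _ _).trans (max_le (e1.trans hρ1.le) ?_)
    rw [norm_mul]
    calc ‖y‖ * ‖1 + σ y‖ ≤ 1 * 1 := mul_le_mul hyn hsy1 (norm_nonneg _) zero_le_one
      _ = 1 := mul_one _
  have e3 : ‖A / (2 * I) - (k : L) * A / (2 * I)‖ ≤ 2⁻¹ := by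
    have e : A / (2 * I) - (k : L) * A / (2 * I) = (((k : L))⁻¹ - 1) * ((k : L) * A / (2 * I)) := by
      field_simp
    rw [e, norm_mul]
    calc ‖((k : L))⁻¹ - 1‖ * ‖(k : L) * A / (2 * I)‖ ≤ 2⁻¹ * 1 :=
          mul_le_mul (UnramifiedDyadic.norm_inv_natCast_sub_one_le hk2) hbk1 (norm_nonneg _)
            (by norm_num)
      _ = 2⁻¹ := mul_one _
  -- the witness `b = A/(2i)`
  refine Set.mem_smul_set.mpr ⟨A / (2 * I), ⟨?_, c, hcσ, hc1, ?_⟩, ?_⟩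
  · rw [map_div₀, map_mul, map_ofNat, h.sigma_I, hσA, mul_neg, neg_div_neg_eq]
  · rw [show A / (2 * I) - (c ^ 2 + c) = (A / (2 * I) - (k : L) * A / (2 * I)) +
        (((k : L) * A / (2 * I) - y * (1 + σ y)) + (y * (1 + σ y) - (c ^ 2 + c))) by ring]
    refine (IsUltrametricDist.norm_add_le_max _ _).trans_lt (max_lt (e3.trans_lt (by norm_num)) ?_)
    exact (IsUltrametricDist.norm_add_le_max _ _).trans_lt (max_lt (e1.trans_lt hρ1) e2)
  · rw [smul_eq_mul, mul_div_cancel₀ _ h2I0, hA]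

/-- **`2i·β ∈ (1 − σ)·log₂(𝒪_Lˣ)` for `β ∈ 2𝒪_F` (PROVED):** `u₁ = 1 + ϖ³·(β/2)` has
`(1 − σ)log₂ u₁ = 2iβ + E`, `‖E‖ ≤ ‖ϖ‖⁵`, `σE = −E` (`(1 − i)ϖ³ = 4i`), and `E` lies in the lattice. -/
theorem smul_mem_asymLogUnits_of_fixed (h : CondFourFrame σ ϖ I) {β : L} (hβσ : σ β = β)
    (hβn : ‖β‖ ≤ ‖(ϖ : L)‖ ^ 2) : 2 * I * β ∈ asymLogUnits σ := by
  have hρ2 := h.rho_sq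
  have hρpos : 0 < ‖(ϖ : L)‖ := norm_pos_iff.mpr ϖ.ne_zero
  have hρ1 : ‖(ϖ : L)‖ < 1 := h.unif.1
  have hI1 := h.norm_I
  have h20 : (2 : L) ≠ 0 := two_ne_zero'
  have hρ75 : ‖(ϖ : L)‖ ^ 7 ≤ ‖(ϖ : L)‖ ^ 5 := pow_le_pow_of_le_one hρpos.le hρ1.le (by norm_num)
  obtain ⟨t, ht⟩ : ∃ t : L, t = β / 2 := ⟨_, rfl⟩
  have htσ : σ t = t := by rw [ht, map_div₀, map_ofNat, hβσ]
  have htn : ‖t‖ ≤ 1 := by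
    rw [ht, norm_div, ← hρ2]; exact div_le_one_of_le₀ hβn (by positivity)
  have hβt : β = 2 * t := by rw [ht]; field_simp
  obtain ⟨x, hx⟩ : ∃ x : L, x = (ϖ : L) ^ 3 * t := ⟨_, rfl⟩
  have hxn : ‖x‖ ≤ ‖(ϖ : L)‖ ^ 3 := by
    rw [hx, norm_mul, norm_pow]; exact mul_le_of_le_one_right (by positivity) htn
  have hxP : ‖1 - (1 + x)‖ < 1 := by
    rw [sub_add_cancel_left, norm_neg]
    exact hxn.trans_lt (pow_lt_one₀ (norm_nonneg _) hρ1 (by norm_num))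
  have hu1 : ‖1 + x‖ = 1 := IsPrincipal.norm_eq_one hxP
  have hσx : σ x = I * x := by
    rw [hx, map_mul, map_pow, h.sigma_unif, htσ]
    linear_combination (-(I * (ϖ : L) ^ 3 * t)) * h.sq_I
  have hxσx : x - σ x = 2 * I * β := by
    rw [hσx, hβt, hx, h.unif_eq]
    linear_combination (t * (-I ^ 2 - 2 * I + 1)) * h.sq_I
  obtain ⟨T, hT⟩ : ∃ T : L, T = unitLog (1 + x) - (x - x ^ 2 / 2) := ⟨_, rfl⟩
  have hTn : ‖T‖ ≤ ‖(ϖ : L)‖ ^ 7 := by rw [hT]; exact norm_unitLog_sub_quadratic_le h.unif h.ram hxn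
  obtain ⟨E, hE⟩ : ∃ E : L, E = (unitLog (1 + x) - σ (unitLog (1 + x))) - 2 * I * β := ⟨_, rfl⟩
  have hEval : E = (T - σ T) - (2 * I * β) * (x + σ x) / 2 := by
    have hu : unitLog (1 + x) = T + (x - x ^ 2 / 2) := by rw [hT]; ring
    have hσu : σ (unitLog (1 + x)) = σ T + (σ x - σ x ^ 2 / 2) := by
      rw [hu, map_add, map_sub, map_div₀, map_pow, map_ofNat]
    rw [hE, hσu, hu, ← hxσx]; ring
  have hEn : ‖E‖ ≤ ‖(ϖ : L)‖ ^ 5 := by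
    rw [hEval]
    refine (norm_sub_le_max' _ _).trans (max_le ?_ ?_)
    · exact (norm_sub_le_max' _ _).trans
        (max_le (hTn.trans hρ75) (by rw [norm_map_sigma]; exact hTn.trans hρ75))
    · rw [norm_div, ← hρ2, div_le_iff₀ (by positivity), norm_mul]
      calc ‖2 * I * β‖ * ‖x + σ x‖ ≤ (‖(ϖ : L)‖ ^ 2 * ‖(ϖ : L)‖ ^ 2) * ‖(ϖ : L)‖ ^ 3 := by
            refine mul_le_mul ?_ ?_ (norm_nonneg _) (by positivity)
            · rw [norm_mul, norm_mul, hI1, mul_one, ← hρ2]; gcongr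
            · exact (IsUltrametricDist.norm_add_le_max _ _).trans
                (max_le hxn (by rw [norm_map_sigma]; exact hxn))
        _ = ‖(ϖ : L)‖ ^ 5 * ‖(ϖ : L)‖ ^ 2 := by ring
  have hEσ : σ E = -E := by
    rw [hE, map_sub, map_sub, h.invol, map_mul, map_mul, map_ofNat, h.sigma_I, hβσ]; ring
  rw [show 2 * I * β = (unitLog (1 + x) - σ (unitLog (1 + x))) - E by rw [hE]; ring]
  exact sub_mem_asymLogUnits (unitLog_sub_mem_asymLogUnits hu1)
    (mem_asymLogUnits_of_norm_le h.unif h.ram hEσ hEn)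

/-- **`2i·AS(F) ⊆ (1 − σ)·log₂(𝒪_Lˣ)` (PROVED):** for `b ∈ AS(F)` with residue witness `c`,
`2ib = (1 − σ)log₂(1 + ϖc) + 2iβ` with `β ∈ L^σ`, `‖β‖ < 1`, hence `‖β‖ ≤ ‖2‖` (no odd fixed valuations)
and `2iβ` is in the lattice. -/
theorem smul_subset_asymLogUnits (h : CondFourFrame σ ϖ I) :
    ((2 : L) * I) • artinSchreierBall σ ⊆ asymLogUnits σ := by
  intro w hw
  obtain ⟨b, ⟨hbσ, c, hcσ, hc1, hbc⟩, rfl⟩ := Set.mem_smul_set.mp hw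
  have hρ2 := h.rho_sq
  have hρpos : 0 < ‖(ϖ : L)‖ := norm_pos_iff.mpr ϖ.ne_zero
  have hρ1 : ‖(ϖ : L)‖ < 1 := h.unif.1
  have hI1 := h.norm_I
  have hI0 := h.I_ne_zero
  have h20 : (2 : L) ≠ 0 := two_ne_zero'
  have h2I0 : (2 : L) * I ≠ 0 := mul_ne_zero h20 hI0
  have hn2I : ‖(2 : L) * I‖ = ‖(ϖ : L)‖ ^ 2 := by rw [norm_mul, hI1, mul_one, ← hρ2]
  have hρ32 : ‖(ϖ : L)‖ ^ 3 < ‖(ϖ : L)‖ ^ 2 := by nlinarith [pow_pos hρpos 2]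
  -- `u₀ = 1 + ϖ c`
  have hϖc : ‖(ϖ : L) * c‖ ≤ ‖(ϖ : L)‖ := by
    rw [norm_mul]; exact mul_le_of_le_one_right hρpos.le hc1
  have hu0P : ‖1 - (1 + (ϖ : L) * c)‖ < 1 := by
    rw [sub_add_cancel_left, norm_neg]; exact hϖc.trans_lt hρ1
  have hu0 : ‖1 + (ϖ : L) * c‖ = 1 := IsPrincipal.norm_eq_one hu0P
  have main := h.norm_asym_sub_le hc1
  rw [hcσ] at main
  obtain ⟨A0, hA0⟩ : ∃ A0 : L, A0 = unitLog (1 + (ϖ : L) * c) - σ (unitLog (1 + (ϖ : L) * c)) :=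
    ⟨_, rfl⟩
  rw [← hA0] at main
  have hA0σ : σ A0 = -A0 := by rw [hA0, map_sub, h.invol]; ring
  have hA0mem : A0 ∈ asymLogUnits σ := hA0 ▸ unitLog_sub_mem_asymLogUnits hu0
  -- `β = b − A0/(2i)`
  obtain ⟨β, hβ⟩ : ∃ β : L, β = b - A0 / (2 * I) := ⟨_, rfl⟩
  have hβσ : σ β = β := by
    rw [hβ, map_sub, hbσ, map_div₀, map_mul, map_ofNat, h.sigma_I, hA0σ, mul_neg, neg_div_neg_eq]
  have hβ1 : ‖β‖ < 1 := by
    have e : β = (b - (c ^ 2 + c)) - (A0 - 2 * I * c * (1 + c)) / (2 * I) := by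
      rw [hβ]; field_simp; ring
    rw [e]
    refine (norm_sub_le_max' _ _).trans_lt (max_lt hbc ?_)
    rw [norm_div, hn2I, div_lt_one (by positivity)]
    exact main.trans_lt hρ32
  have hβ2 : ‖β‖ ≤ ‖(ϖ : L)‖ ^ 2 := h.norm_le_sq_of_fixed hβσ hβ1
  rw [show ((2 : L) * I) • b = A0 + 2 * I * β by rw [smul_eq_mul, hβ]; field_simp; ring]
  exact add_mem_asymLogUnits hA0mem (h.smul_mem_asymLogUnits_of_fixed hβσ hβ2)

/-- **IMLAW at conductor 4 — PROVED:** `(1 − σ)·log₂(𝒪_Lˣ) = 2i·AS(F)`. -/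
theorem imLawFour (h : CondFourFrame σ ϖ I) : ImLawFour σ I :=
  Subset.antisymm h.asymLogUnits_subset_smul h.smul_subset_asymLogUnits

/-- **KEYED LAW, conductor-4 keys — PROVED:** `log₂(U¹(L)^{N_σ = 1}) = 2i·AS(F)` — the table entry
`log₂ H¹(F_n, T(key)) = 2i·AS_n` of STUB-PLAN §3 (xxiv) for `u = −1` (all `n`) and `u = 3` (`n ≥ 1`). -/
theorem keyedLawFour (h : CondFourFrame σ ϖ I) :
    unitLog '' normOnePrincipal σ = ((2 : L) * I) • artinSchreierBall σ :=
  keyedLawFour_of_ImLawFour σ h.invol (norm_sigma_sub_lt_one σ h.res) h.unif h.sq_I h.sigma_I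
    h.unif_eq h.imLawFour

end CondFourFrame

end Four

end Summit.BirchSwinnertonDyer.BirchSwinnertonDyer.Cruxes.SplitBadTwoLowerHalfOfFacts.KeyedLawK3G31

end
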